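import Summits.QuantumFields.YangMills.Theorems.LuscherReductionRunningReductionKTRCalibration
import Summits.QuantumFields.YangMills.Theorems.LuscherReductionRunningReductionKTRCertificate
import HarnessLib

/-!
# Crux RED `RunningReduction`, line «KTR», stub `stub_dressedRitz` (rev 3): the GENERATOR ∕ GEVP form `RitzGenerators`
# and the kernel-checked equivalence `RitzGenerators ↔ DressedRitz`

Planner ym-cruxidea-19978-1 GEN 4 (crux-ideate seat, levers (b)∕(c)) for `stmt-QuantumFields-19978` (route `LuscherReduction`,
crux RED `RunningReduction`), line of record «KTR» rev 2 (`pub/ym-beyond/p1-g16-files/Lines-KTR.lean` sha16 3cffefe53154727e).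
LOCATED STRUCTURE under the hardest registered stub `stub_dressedRitz` (= `KT.DressedRitz` rev 3, this seat's residual-Gram repair):
the prover of that stub need NOT produce an `l2`-orthonormal `qform`-diagonal family.  It suffices to produce `k+1` GENERATORS —
physical unit vectors `v₀ … v_k` (intended: Euclidean-time-smoothed lifted one-site eigenfunctions `K_β^n(h_j·Φ_M)`, `n ≈ t₀L/2`,
`t₀ ≈ (3/4π) log(1/λ)` uniform in `L`; see `MEMO-DressedRitz-GEVP.md`) with

* (g1) Gram conditioning `Σ c_i² ≤ 2‖Σ c_i v_i‖²` (near-orthogonality),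
* (g2) PER-GENERATOR one-step residuals `‖K_β v_i − ⟨v_i,K_βv_i⟩ v_i‖² ≤ C(λ³/L²) m₀²` (`m₀ = ritzValue β v 0`, the top in-span value) —
  a bound on THREE two-point functions `⟨v_i,v_i⟩, ⟨v_i,K v_i⟩, ⟨v_i,K²v_i⟩` per generator, i.e. an effective-mass PLATEAU condition,
* (g3) the in-span min–max values (`ritzValue`, tree `…KTDefs`) in Lüscher position: `ritzValue_j / ritzValue_0 = μ_j/μ_0 · e^{±Cλ²/L}`
  (the generalised-eigenvalue-problem (GEVP) eigenvalues of the `(k+1)×(k+1)` correlator pencil `(⟨v_i,K v_l⟩, ⟨v_i,v_l⟩)`),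
* (g4) coarse top capture `⟨ψ,K_βψ⟩ ≤ e^{ηλ/L} ritzValue_0 ‖ψ‖²`.

THEOREMS (sorry-free, tree imports only): `residualGram_le_of_generators` (operator-free LEMMA A: for ANY `ip`-orthonormal `K`-diagonal
basis `u` of the span of generators with Gram `≥ g` and per-generator residuals `≤ ρ`, the residual Gram form of `u` is `≤ (nρ/g) Σ c_i²` —
the span residual `Σ c_i r_i = Kψ − s` is the `ip`-shortest vector `Kψ − x`, `x ∈ span`, and `x = Σ b_l d_l v_l` is admissible);
`dressedRitz_of_ritzGenerators : RitzGenerators → DressedRitz` (Ritz rotation `exists_orthonormal_formDiagonal_antitone` + in-span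
Courant–Fischer `ritzValue_eq_ritzDiag` + Lemma A with `g = 1/2`, constant `2(k+1)·max C 0`); `ritzGenerators_of_dressedRitz` (converse:
a dressed Ritz family is a generator family); hence `ritzGenerators_iff_dressedRitz`.  With the tree's calibration
`KTRCalibration.dressedRitz_of_runningReduction` (RED ∧ attainment ⟹ DressedRitz): RED ⟹ DressedRitz ⟺ RitzGenerators, and
RitzGenerators ∧ 3a′ ∧ 3b′ ∧ ONE ⟹ RED (`Lines-KTR.lean: RunningReduction_of`).  `DressedRitz` below is the VERBATIM rev-3 text.

HONEST FRAMING: fixed-lattice linear algebra (Rayleigh–Ritz ∕ GEVP bookkeeping) over tree objects; an EQUIVALENT re-typing of one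
registered stub, of operational value only (it names the correlator data a constructive-RG prover must deliver); proves nothing of RED,
3a′∕3b′ or attainment; femto rung R2b1 only — no bearing on infinite volume, the continuum limit or the Clay mass gap.
References: Lüscher–Wolff, Nucl. Phys. B 339 (1990) 222 (GEVP); Blossier–Della Morte–von Hippel–Mendes–Sommer, JHEP 04 (2009) 094
(GEVP effective masses, corrections `e^{−(E_{N+1}−E_n)t}`); Golub–Van Loan §8.7 [cite: GolubVanLoan2013, §8.7.1]; Reed–Simon IV XIII.1–2
[cite: ReedSimonIV1978, XIII.1–2].

## Module rev 3 (GEN 5, 2026-08-27) — two additions, both sorry-free, tree imports only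

* §8/§10 **NON-VACUITY CERTIFICATES** `excitedPlateau_of_runningReduction_oneSiteLevels : RunningReduction → OneSiteLevels → ExcitedPlateau`
  (hence `→ DiagonalPlateau`, `→ RitzGenerators`; witnesses = the exact physical orthonormal eigenfamily of `PhysL2.exists_isPhys_eigenfamily`;
  (x5)/(p3) IS RED, (x7)/(p5) is the pure-real `spread_le_of_red_one` from the LOWER laws of RED ∧ ONE plus `levelValue_antitone`).  So both
  GEVP-free cuts (§7, §9) are implied by the route's two cruxes — satisfiable exactly when they hold, neither vacuous nor over-strong (the g3
  lesson: a typed cut handed to provers must be certified).  Reading: `RED ∧ ONE ⟹ ExcitedPlateau ⟹ DiagonalPlateau ⟹ RitzGenerators ⟺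
  DressedRitz`, and `DressedRitz ∧ {3a′∧3b′ | explicit} ∧ ONE ⟹ RED` («KTR» compositions).
* §9 **THE VACUUM GENERATOR IS EXACT**: the excited-sector cut `ExcitedPlateau` (data on `k` excited generators only — vacuum overlaps
  `|⟨Ω,w_i⟩| ≤ Cλ`, residual plateaus, Lüscher position against the exact `λ₀`, excited couplings, spread; NO top-capture clause, NO margin `η`,
  no smoothing of the vacuum) and `diagonalPlateau_of_excitedPlateau : ExcitedPlateau → DiagonalPlateau` (`v₀ := Ω`, an exact physical unit
  ground state of `K_β`, for which (p6), the vacuum residual, the vacuum Lüscher position and — via `qform(Ω,w) = λ₀⟨Ω,w⟩` — the vacuum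
  couplings are automatic).  Chain for the prover of `stub_dressedRitz`: `ExcitedPlateau → DiagonalPlateau → RitzGenerators → DressedRitz`.
(rev 3 also writes the gauge group as `Theorems.FemtoTransferGap.SU2`: the new import makes the bare name ambiguous with the Literature copy; same type.)
-/

set_option autoImplicit false

noncomputable section

open MeasureTheory Filter Topology Real
open Literature.MathematicalPhysics.QuantumFieldTheory
open Literature.MathematicalPhysics.QuantumLattice
open Literature.Analysis.OperatorTheory.YMMatrixModel
open Literature.Analysis.OperatorTheory
open Literature.Analysis.OperatorTheory.ClusterKatoTemple
open scoped BigOperators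

namespace Summit.QuantumFields.YangMills.Cruxes.RunningReduction.KTGen

open Summit.QuantumFields.YangMills.Theorems.FemtoTransferGap
open Summit.QuantumFields.YangMills.Theorems.FemtoTransferGap.KTRCalibration
open Summit.QuantumFields.YangMills.Theorems.FemtoTransferGap.PhysL2

/-! ## §0 LEMMA A (operator-free): the residual Gram form of a Ritz basis from per-generator residuals -/

section Generators

variable {D : Type*} [AddCommGroup D] [Module ℝ D]

/-- `2·ip(a,b) ≤ ip(a,a) + ip(b,b)` for a positive semidefinite symmetric form. [folklore] -/
theorem two_mul_bilin_le (ip : D →ₗ[ℝ] D →ₗ[ℝ] ℝ) (hsymm : ∀ x y, ip x y = ip y x) (hpos : ∀ x, 0 ≤ ip x x)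
    (a b : D) : 2 * ip a b ≤ ip a a + ip b b := by
  have h := hpos (a - b)
  simp only [map_sub, LinearMap.sub_apply] at h
  rw [hsymm b a] at h
  linarith

/-- `ip(Σ_l y_l, Σ_l y_l) ≤ n · Σ_l ip(y_l, y_l)` (`n` terms) for a positive semidefinite symmetric form. [folklore] -/
theorem bilin_sum_self_le (ip : D →ₗ[ℝ] D →ₗ[ℝ] ℝ) (hsymm : ∀ x y, ip x y = ip y x) (hpos : ∀ x, 0 ≤ ip x x)
    {n : ℕ} (y : Fin n → D) :
    ip (∑ l, y l) (∑ l, y l) ≤ (n : ℝ) * ∑ l, ip (y l) (y l) := by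
  have hexp : ip (∑ i, y i) (∑ l, y l) = ∑ i, ∑ l, ip (y i) (y l) := by
    have h := bilin_sum_smul_sum_smul ip (fun _ => (1 : ℝ)) (fun _ => (1 : ℝ)) y y
    simp only [one_smul, one_mul] at h
    exact h
  rw [hexp]
  set f : Fin n → ℝ := fun l => ip (y l) (y l) with hf
  have h1 : ∑ i, ∑ l, ip (y i) (y l) ≤ ∑ i, ∑ l, (f i + f l) / 2 := by
    refine Finset.sum_le_sum fun i _ => Finset.sum_le_sum fun l _ => ?_
    have := two_mul_bilin_le ip hsymm hpos (y i) (y l)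
    simp only [hf]
    linarith
  have h2 : ∑ i : Fin n, ∑ l : Fin n, (f i + f l) / 2 = (n : ℝ) * ∑ l, f l := by
    have hin : ∀ i : Fin n, ∑ l : Fin n, (f i + f l) / 2 = ((n : ℝ) * f i + ∑ l, f l) / 2 := by
      intro i
      rw [← Finset.sum_div, Finset.sum_add_distrib, Finset.sum_const, Finset.card_univ, Fintype.card_fin,
        nsmul_eq_mul]
    rw [Finset.sum_congr rfl fun i _ => hin i, ← Finset.sum_div, Finset.sum_add_distrib, Finset.sum_const,
      Finset.card_univ, Fintype.card_fin, nsmul_eq_mul, ← Finset.mul_sum]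
    ring
  calc ∑ i, ∑ l, ip (y i) (y l) ≤ ∑ i, ∑ l, (f i + f l) / 2 := h1
    _ = (n : ℝ) * ∑ l, f l := h2

/-- **LEMMA A — residual Gram form of a Ritz basis from per-generator residuals.**  `ip` symmetric positive semidefinite, `K`
`ip`-symmetric; generators `v₀ … v_{n−1}` with Gram conditioning `g Σ b_l² ≤ ip(Σ b_l v_l, Σ b_l v_l)` (`g > 0`) and per-generator
residuals `ip((K − d_l)v_l, (K − d_l)v_l) ≤ ρ` (any scalars `d_l`); `u₀ … u_{k−1}` an `ip`-orthonormal `K`-diagonal family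
(`ip(u_i, K u_l) = m_i δ_il`) with `span u = span v`.  Then the residual Gram form of `u` obeys
`ip(Σ c_i (K u_i − m_i u_i), Σ c_i (K u_i − m_i u_i)) ≤ (n ρ / g) Σ c_i²`.
Proof: `r = Σ c_i (K u_i − m_i u_i) = Kψ − s` (`ψ = Σ c_i u_i`, `s ∈ span`) is `ip`-orthogonal to the span, so `ip(r,r) ≤ ip(Kψ − x, Kψ − x)`
for every `x` in the span (Pythagoras); with `ψ = Σ b_l v_l` take `x = Σ b_l d_l v_l`: `Kψ − x = Σ b_l (K − d_l) v_l` has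
`ip`-square `≤ n ρ Σ b_l² ≤ n ρ ip(ψ,ψ)/g = (nρ/g) Σ c_i²`. [folklore; cite: GolubVanLoan2013, §8.1.1] -/
theorem residualGram_le_of_generators (ip : D →ₗ[ℝ] D →ₗ[ℝ] ℝ)
    (hip_symm : ∀ x y, ip x y = ip y x) (hip_nonneg : ∀ x, 0 ≤ ip x x)
    (K : D →ₗ[ℝ] D) (hK : ∀ x y, ip (K x) y = ip x (K y))
    {n k : ℕ} (v : Fin n → D) (d : Fin n → ℝ) (u : Fin k → D) (m : Fin k → ℝ)
    (hon : ∀ i l, ip (u i) (u l) = if i = l then 1 else 0)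
    (hritz : ∀ i l, ip (u i) (K (u l)) = if i = l then m i else 0)
    (huv : ∀ i, u i ∈ Submodule.span ℝ (Set.range v))
    (hvu : ∀ l, v l ∈ Submodule.span ℝ (Set.range u))
    {g ρ : ℝ} (hg : 0 < g) (hρ : 0 ≤ ρ)
    (hgram : ∀ b : Fin n → ℝ, g * ∑ l, b l ^ 2 ≤ ip (∑ l, b l • v l) (∑ l, b l • v l))
    (hres : ∀ l, ip (K (v l) - d l • v l) (K (v l) - d l • v l) ≤ ρ)
    (c : Fin k → ℝ) :
    ip (∑ i, c i • (K (u i) - m i • u i)) (∑ i, c i • (K (u i) - m i • u i)) ≤ ((n : ℝ) * ρ / g) * ∑ i, c i ^ 2 := by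
  classical
  -- `ψ = Σ c_i u_i ∈ span v`; write `ψ = Σ b_l v_l`
  set ψ : D := ∑ i, c i • u i with hψ
  have hψv : ψ ∈ Submodule.span ℝ (Set.range v) :=
    Submodule.sum_mem _ fun i _ => Submodule.smul_mem _ _ (huv i)
  obtain ⟨b, hb⟩ := (Submodule.mem_span_range_iff_exists_fun ℝ).mp hψv
  -- the residual combination `r = Kψ − s`
  set r : D := ∑ i, c i • (K (u i) - m i • u i) with hr
  set s : D := ∑ i, (c i * m i) • u i with hs
  have hrψ : r = K ψ - s := by
    rw [hr, hψ, hs, map_sum, ← Finset.sum_sub_distrib]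
    refine Finset.sum_congr rfl fun i _ => ?_
    rw [map_smul, smul_sub, smul_smul]
  -- `r ⊥ u_l`, hence `r ⊥ span u`
  have hru : ∀ l, ip r (u l) = 0 := by
    intro l
    rw [hr, bilin_sum_smul_left]
    refine Finset.sum_eq_zero fun i _ => ?_
    have h0 : ip (K (u i) - m i • u i) (u l) = 0 := by
      simp only [map_sub, map_smul, LinearMap.sub_apply, LinearMap.smul_apply, smul_eq_mul]
      rw [hK, hritz, hon]
      split_ifs <;> ring
    rw [h0, mul_zero]
  have hrspan : ∀ w ∈ Submodule.span ℝ (Set.range u), ip r w = 0 := by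
    intro w hw
    have hle : Submodule.span ℝ (Set.range u) ≤ LinearMap.ker (ip r) := by
      refine Submodule.span_le.mpr ?_
      rintro _ ⟨l, rfl⟩
      exact LinearMap.mem_ker.mpr (hru l)
    exact LinearMap.mem_ker.mp (hle hw)
  -- the comparison vector `x = Σ b_l d_l v_l ∈ span u`, and `s ∈ span u`
  set x : D := ∑ l, (b l * d l) • v l with hx
  have hxu : x ∈ Submodule.span ℝ (Set.range u) :=
    Submodule.sum_mem _ fun l _ => Submodule.smul_mem _ _ (hvu l)
  have hsu : s ∈ Submodule.span ℝ (Set.range u) :=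
    Submodule.sum_mem _ fun i _ => Submodule.smul_mem _ _ (Submodule.subset_span (Set.mem_range_self i))
  -- Pythagoras: `ip r r ≤ ip (Kψ − x) (Kψ − x)`
  have hpyth : ip r r ≤ ip (K ψ - x) (K ψ - x) := by
    have hdec : K ψ - x = r + (s - x) := by rw [hrψ]; abel
    have h0 : ip r (s - x) = 0 := hrspan _ (Submodule.sub_mem _ hsu hxu)
    have h0' : ip (s - x) r = 0 := by rw [hip_symm]; exact h0
    rw [hdec]
    simp only [map_add, LinearMap.add_apply]
    rw [h0, h0']
    have := hip_nonneg (s - x)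
    linarith
  -- `Kψ − x = Σ b_l (K v_l − d_l v_l)`
  have hKψx : K ψ - x = ∑ l, b l • (K (v l) - d l • v l) := by
    rw [← hb, hx, map_sum, ← Finset.sum_sub_distrib]
    refine Finset.sum_congr rfl fun l _ => ?_
    rw [map_smul, smul_sub, smul_smul]
  have hsum : ip (K ψ - x) (K ψ - x) ≤ (n : ℝ) * (ρ * ∑ l, b l ^ 2) := by
    rw [hKψx]
    refine (bilin_sum_self_le ip hip_symm hip_nonneg _).trans ?_
    refine mul_le_mul_of_nonneg_left ?_ (Nat.cast_nonneg n)
    rw [Finset.mul_sum]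
    refine Finset.sum_le_sum fun l _ => ?_
    simp only [map_smul, LinearMap.smul_apply, smul_eq_mul]
    have h1 := hres l
    have hb2 : 0 ≤ b l * b l := mul_self_nonneg _
    nlinarith
  -- `g Σ b_l² ≤ ip ψ ψ = Σ c_i²`
  have hψψ : ip ψ ψ = ∑ i, c i ^ 2 := by
    rw [hψ, bilin_sum_smul_sum_smul]
    refine Finset.sum_congr rfl fun i _ => ?_
    simp only [hon, mul_ite, mul_one, mul_zero, Finset.sum_ite_eq, Finset.mem_univ, if_true]
    ring
  have hbsum : g * ∑ l, b l ^ 2 ≤ ∑ i, c i ^ 2 := by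
    rw [← hψψ, ← hb]
    exact hgram b
  have hb_le : ∑ l, b l ^ 2 ≤ (∑ i, c i ^ 2) / g := by
    rw [le_div_iff₀ hg]
    linarith
  calc ip r r ≤ (n : ℝ) * (ρ * ∑ l, b l ^ 2) := hpyth.trans hsum
    _ ≤ (n : ℝ) * (ρ * ((∑ i, c i ^ 2) / g)) :=
        mul_le_mul_of_nonneg_left (mul_le_mul_of_nonneg_left hb_le hρ) (Nat.cast_nonneg n)
    _ = ((n : ℝ) * ρ / g) * ∑ i, c i ^ 2 := by ring

end Generators

/-! ## §1 The statements: `DressedRitz` (VERBATIM rev 3, `Lines-KTR.lean` part 3) and its generator ∕ GEVP form `RitzGenerators` -/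

/-- **`DressedRitz` (rev 3)** — VERBATIM copy of `Summit.QuantumFields.YangMills.Cruxes.RunningReduction.KT.DressedRitz` of the skeleton of
record `Lines-KTR.lean` (sha16 3cffefe53154727e; = `Stmt.stub_dressedRitz`), so that the theorems below are definitionally about the registered
stub text (the skeleton lives in a pub folder and is not importable; same device as the tree's `KTDoorR3` ∕ `KTRCalibration`). -/
def DressedRitz : Prop :=
  ∀ k : ℕ, ∀ η : ℝ, 0 < η → ∃ C lam0 : ℝ, 0 < lam0 ∧ ∀ lam : ℝ, 0 < lam → lam ≤ lam0 →
    ∃ L0 : ℕ, ∀ (L : ℕ) [NeZero L], L0 ≤ L → ∀ β : ℝ, InFemtoWindow lam β L →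
      ∃ φ : Fin (k + 1) → (GaugeConfig 3 L Theorems.FemtoTransferGap.SU2 → ℝ),
        (∀ i, IsPhys (φ i)) ∧
        (∀ i l, l2 (φ i) (φ l) = if i = l then 1 else 0) ∧
        (∀ i l, i ≠ l → qform su2Rep β (φ i) (φ l) = 0) ∧
        (∀ i l : Fin (k + 1), i ≤ l → qform su2Rep β (φ l) (φ l) ≤ qform su2Rep β (φ i) (φ i)) ∧
        (∀ j : Fin (k + 1),
          qform su2Rep β (φ j) (φ j) * levelValue su2Rep 1 (oneSiteCoupling β L) 0 ≤
              Real.exp (C * luscherLambda β L ^ 2 / L) *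
                (levelValue su2Rep 1 (oneSiteCoupling β L) j * qform su2Rep β (φ 0) (φ 0)) ∧
            levelValue su2Rep 1 (oneSiteCoupling β L) j * qform su2Rep β (φ 0) (φ 0) ≤
              Real.exp (C * luscherLambda β L ^ 2 / L) *
                (qform su2Rep β (φ j) (φ j) * levelValue su2Rep 1 (oneSiteCoupling β L) 0)) ∧
        (∀ c : Fin (k + 1) → ℝ,
          l2 (∑ i, c i • (transferApply β (φ i) - qform su2Rep β (φ i) (φ i) • φ i))
             (∑ i, c i • (transferApply β (φ i) - qform su2Rep β (φ i) (φ i) • φ i)) ≤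
            C * (luscherLambda β L ^ 3 / (L : ℝ) ^ 2) * qform su2Rep β (φ 0) (φ 0) ^ 2 * ∑ i, c i ^ 2) ∧
        (∀ ψ : GaugeConfig 3 L Theorems.FemtoTransferGap.SU2 → ℝ, IsPhys ψ →
          qform su2Rep β ψ ψ ≤ Real.exp (η * luscherLambda β L / L) * qform su2Rep β (φ 0) (φ 0) * l2 ψ ψ)

/-- **`RitzGenerators` — the generator ∕ GEVP form of `DressedRitz`.**  For every level `k` and `η > 0`, eventually in the femto window, there
are `k+1` PHYSICAL UNIT VECTORS `v₀ … v_k` (no orthogonality, no diagonality required) with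
(g1) Gram conditioning `Σ c_i² ≤ 2 ‖Σ c_i v_i‖²`;
(g2) per-generator one-step residuals `‖K_β v_i − ⟨v_i,K_β v_i⟩ v_i‖² ≤ C (λ³/L²) m₀²`, `m₀ := ritzValue β v 0` (top in-span value) —
     three two-point functions `⟨v_i,v_i⟩, ⟨v_i,K_βv_i⟩, ⟨v_i,K_β²v_i⟩` per generator (an effective-mass plateau at one Euclidean time step);
(g3) the in-span min–max values in Lüscher position: `ritzValue_j · μ_0 ≤ e^{Cλ²/L} μ_j · ritzValue_0` and
     `μ_j · ritzValue_0 ≤ e^{Cλ²/L} ritzValue_j · μ_0` for `j ≤ k` (`μ_j` = one-site values at `B = 2L³/λ³`; the GEVP eigenvalues of the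
     correlator pencil `(⟨v_i,K_βv_l⟩, ⟨v_i,v_l⟩)`);
(g4) coarse top capture `⟨ψ,K_βψ⟩ ≤ e^{ηλ/L} ritzValue_0 ‖ψ‖²` for all physical `ψ`.
EQUIVALENT to `DressedRitz` (`ritzGenerators_iff_dressedRitz`); intended witnesses and the Euclidean dictionary: `MEMO-DressedRitz-GEVP.md`. -/
def RitzGenerators : Prop :=
  ∀ k : ℕ, ∀ η : ℝ, 0 < η → ∃ C lam0 : ℝ, 0 < lam0 ∧ ∀ lam : ℝ, 0 < lam → lam ≤ lam0 →
    ∃ L0 : ℕ, ∀ (L : ℕ) [NeZero L], L0 ≤ L → ∀ β : ℝ, InFemtoWindow lam β L →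
      ∃ v : Fin (k + 1) → (GaugeConfig 3 L Theorems.FemtoTransferGap.SU2 → ℝ),
        (∀ i, IsPhys (v i)) ∧
        (∀ i, l2 (v i) (v i) = 1) ∧
        (∀ c : Fin (k + 1) → ℝ, ∑ i, c i ^ 2 ≤ 2 * l2 (∑ i, c i • v i) (∑ i, c i • v i)) ∧
        (∀ i, l2 (transferApply β (v i) - qform su2Rep β (v i) (v i) • v i)
                 (transferApply β (v i) - qform su2Rep β (v i) (v i) • v i) ≤
            C * (luscherLambda β L ^ 3 / (L : ℝ) ^ 2) * ritzValue β v 0 ^ 2) ∧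
        (∀ j : ℕ, j ≤ k →
          ritzValue β v j * levelValue su2Rep 1 (oneSiteCoupling β L) 0 ≤
              Real.exp (C * luscherLambda β L ^ 2 / L) * (levelValue su2Rep 1 (oneSiteCoupling β L) j * ritzValue β v 0) ∧
          levelValue su2Rep 1 (oneSiteCoupling β L) j * ritzValue β v 0 ≤
              Real.exp (C * luscherLambda β L ^ 2 / L) * (ritzValue β v j * levelValue su2Rep 1 (oneSiteCoupling β L) 0)) ∧
        (∀ ψ : GaugeConfig 3 L Theorems.FemtoTransferGap.SU2 → ℝ, IsPhys ψ →
          qform su2Rep β ψ ψ ≤ Real.exp (η * luscherLambda β L / L) * ritzValue β v 0 * l2 ψ ψ)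

/-! ## §2 Coercion bookkeeping between the physical subspace and the function space -/

variable {L : ℕ} [NeZero L]

omit [NeZero L] in
/-- The underlying function of a finite combination in the physical subspace. [folklore] -/
theorem coe_sum_smul {n : ℕ} (c : Fin n → ℝ) (V : Fin n → physSubmodule L) :
    ((∑ i, c i • V i : physSubmodule L) : GaugeConfig 3 L Theorems.FemtoTransferGap.SU2 → ℝ) = ∑ i, c i • (V i : GaugeConfig 3 L Theorems.FemtoTransferGap.SU2 → ℝ) := by
  rw [Submodule.coe_sum]
  refine Finset.sum_congr rfl fun i _ => ?_
  rw [Submodule.coe_smul]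

/-- The underlying function of a finite combination of packaged residuals `K u_i − m_i u_i`. [folklore] -/
theorem coe_sum_smul_residual (β : ℝ) {n : ℕ} (u : Fin n → physSubmodule L) (m : Fin n → ℝ) (c : Fin n → ℝ) :
    ((∑ i, c i • (transferOp β (u i) - m i • u i) : physSubmodule L) : GaugeConfig 3 L Theorems.FemtoTransferGap.SU2 → ℝ) =
      ∑ i, c i • (transferApply β (u i : GaugeConfig 3 L Theorems.FemtoTransferGap.SU2 → ℝ) - m i • (u i : GaugeConfig 3 L Theorems.FemtoTransferGap.SU2 → ℝ)) := by
  rw [Submodule.coe_sum]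
  refine Finset.sum_congr rfl fun i _ => ?_
  rw [Submodule.coe_smul, Submodule.coe_sub, Submodule.coe_smul, coe_transferOp]

/-- The underlying function of one packaged residual `K V − d V`. [folklore] -/
theorem coe_residual (β d : ℝ) (V : physSubmodule L) :
    ((transferOp β V - d • V : physSubmodule L) : GaugeConfig 3 L Theorems.FemtoTransferGap.SU2 → ℝ) =
      transferApply β (V : GaugeConfig 3 L Theorems.FemtoTransferGap.SU2 → ℝ) - d • (V : GaugeConfig 3 L Theorems.FemtoTransferGap.SU2 → ℝ) := by
  rw [Submodule.coe_sub, Submodule.coe_smul, coe_transferOp]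

/-! ## §3 `RitzGenerators → DressedRitz`: Ritz rotation + in-span Courant–Fischer + LEMMA A -/

/-- **The generator form implies the rev-3 stub.**  Given generators `v` (g1)–(g4) at `(L, β)`: the Gram matrix is positive definite (g1), so the
span carries an `l2`-orthonormal `qform`-diagonal basis `u` with decreasing Ritz data `m` (`exists_orthonormal_formDiagonal_antitone`); by in-span
Courant–Fischer `ritzValue β v j = m_j` (`ritzValue_eq_ritzDiag`), so (g3) is clause (i) and (g4) is clause (iii) for `φ = u`; LEMMA A with `g = 1/2`,
`n = k+1`, `ρ = max C 0 · (λ³/L²) m₀²` turns (g2) into the residual Gram bound (ii′) with constant `2(k+1)·max C 0`. -/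
theorem dressedRitz_of_ritzGenerators (h : RitzGenerators) : DressedRitz := by
  intro k η hη
  obtain ⟨C, lam0, hlam0, hC⟩ := h k η hη
  set C' : ℝ := max C 0 with hC'def
  have hC'0 : 0 ≤ C' := le_max_right C 0
  have hCC' : C ≤ C' := le_max_left C 0
  set CD : ℝ := 2 * ((k : ℝ) + 1) * C' with hCDdef
  have hC'CD : C' ≤ CD := by
    rw [hCDdef]
    exact le_mul_of_one_le_left hC'0 (by have := (Nat.cast_nonneg k : (0 : ℝ) ≤ k); linarith)
  have hCCD : C ≤ CD := hCC'.trans hC'CD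
  refine ⟨CD, lam0, hlam0, fun lam hlam hle => ?_⟩
  obtain ⟨L0, hL0⟩ := hC lam hlam hle
  refine ⟨L0, fun L _ hL β hW => ?_⟩
  obtain ⟨v, hphys, hnorm, hgram, hres, hritz, htop⟩ := hL0 L hL β hW
  have hβ1 : (1 : ℝ) ≤ β := hW.1
  have hβ0 : (0 : ℝ) ≤ β := zero_le_one.trans hβ1
  have hx0 : 0 ≤ luscherLambda β L := luscherLambda_nonneg β L
  have hs0 : 0 ≤ luscherLambda β L ^ 2 / (L : ℝ) := div_nonneg (sq_nonneg _) (Nat.cast_nonneg L)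
  have hx3 : 0 ≤ luscherLambda β L ^ 3 / (L : ℝ) ^ 2 := div_nonneg (pow_nonneg hx0 3) (sq_nonneg _)
  -- the packaged family and the operator-free data
  let V : Fin (k + 1) → physSubmodule L := fun i => ⟨v i, hphys i⟩
  have hVv : (fun i => (V i : GaugeConfig 3 L Theorems.FemtoTransferGap.SU2 → ℝ)) = v := rfl
  set ip := l2Form L with hip
  set K := transferOp (L := L) β with hK
  set E : physSubmodule L →ₗ[ℝ] physSubmodule L →ₗ[ℝ] ℝ := ip.compl₂ K with hE
  have hE_apply : ∀ x y, E x y = ip x (K y) := fun x y => LinearMap.compl₂_apply _ _ _ _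
  have hip_symm : ∀ x y, ip x y = ip y x := l2Form_symm
  have hip_nonneg : ∀ x, 0 ≤ ip x x := l2Form_self_nonneg
  have hKsymm : ∀ x y, ip (K x) y = ip x (K y) := transferOp_symm β
  have hE_symm : ∀ x y, E x y = E y x := fun x y => by
    rw [hE_apply, hE_apply, ← hKsymm, hip_symm]
  -- (g1) ⇒ the Gram matrix is positive definite, with conditioning `1/2`
  have hgram' : ∀ b : Fin (k + 1) → ℝ, (1 / 2 : ℝ) * ∑ l, b l ^ 2 ≤ ip (∑ l, b l • V l) (∑ l, b l • V l) := by
    intro b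
    rw [hip, l2Form_apply, coe_sum_smul]
    have := hgram b
    linarith
  have hG : (Matrix.of fun i l => ip (V i) (V l)).PosDef := by
    refine Matrix.posDef_iff_dotProduct_mulVec.mpr ⟨?_, fun c hc => ?_⟩
    · ext i l
      simp only [Matrix.conjTranspose_apply, Matrix.of_apply, star_trivial, hip_symm (V l) (V i)]
    · have hquad : dotProduct (star c) (Matrix.mulVec (Matrix.of fun i l => ip (V i) (V l)) c) =
          ip (∑ i, c i • V i) (∑ l, c l • V l) := by
        rw [bilin_sum_smul_sum_smul, star_trivial, dotProduct]
        refine Finset.sum_congr rfl fun i _ => ?_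
        rw [Matrix.mulVec, dotProduct, Finset.mul_sum]
        refine Finset.sum_congr rfl fun l _ => ?_
        simp only [Matrix.of_apply]
        ring
      rw [hquad]
      have hpos : 0 < ∑ i, c i ^ 2 := by
        obtain ⟨i, hi⟩ : ∃ i, c i ≠ 0 := by
          by_contra h0
          push Not at h0
          exact hc (funext h0)
        exact lt_of_lt_of_le (by positivity : 0 < c i ^ 2)
          (Finset.single_le_sum (fun l _ => sq_nonneg (c l)) (Finset.mem_univ i))
      have := hgram' c
      linarith
  -- Rayleigh–Ritz diagonalisation inside the span, sorted
  obtain ⟨u, m, hanti, hu', hon', hdiag'⟩ := exists_orthonormal_formDiagonal_antitone ip E hE_symm V hG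
  have hu : ∀ i, (u i : GaugeConfig 3 L Theorems.FemtoTransferGap.SU2 → ℝ) ∈ Submodule.span ℝ (Set.range v) := fun i => by
    rw [← hVv, ← coe_mem_span_iff]; exact hu' i
  have hon : ∀ i l, l2 (u i : GaugeConfig 3 L Theorems.FemtoTransferGap.SU2 → ℝ) (u l) = if i = l then 1 else 0 := fun i l => by
    rw [← l2Form_apply]; exact hon' i l
  have hdiag : ∀ i l, qform su2Rep β (u i : GaugeConfig 3 L Theorems.FemtoTransferGap.SU2 → ℝ) (u l) = if i = l then m i else 0 := fun i l => by
    rw [← l2Form_transferOp_right, ← hE_apply]; exact hdiag' i l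
  have hritz' : ∀ i l, ip (u i) (K (u l)) = if i = l then m i else 0 := fun i l => by
    rw [← hE_apply]; exact hdiag' i l
  have hspan := span_coe_eq_span v u hu hon
  have hvu : ∀ l, V l ∈ Submodule.span ℝ (Set.range u) := fun l => by
    rw [coe_mem_span_iff, hspan]
    exact Submodule.subset_span ⟨l, rfl⟩
  have hq : ∀ i, qform su2Rep β (u i : GaugeConfig 3 L Theorems.FemtoTransferGap.SU2 → ℝ) (u i) = m i := fun i => by rw [hdiag, if_pos rfl]
  have hm0 : ∀ i, 0 ≤ m i := fun i => by rw [← hq i]; exact qform_su2Rep_self_nonneg hβ0 (isPhys_coe _)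
  -- in-span Courant–Fischer: the Ritz values of `v` ARE the sorted Ritz data
  have hRj : ∀ j : Fin (k + 1), ritzValue β v j = m j := fun j => by
    have hj : (j : ℕ) ≤ k := Nat.le_of_lt_succ j.2
    have h := ritzValue_eq_ritzDiag hβ0 hphys hu hon hdiag hanti hj
    rw [Fin.eta] at h
    exact h
  have hR0 : ritzValue β v 0 = m 0 := by
    have h := hRj 0
    exact h
  -- the residual scale
  set ρ : ℝ := C' * (luscherLambda β L ^ 3 / (L : ℝ) ^ 2) * m 0 ^ 2 with hρdef
  have hρ0 : 0 ≤ ρ := mul_nonneg (mul_nonneg hC'0 hx3) (sq_nonneg _)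
  have hres' : ∀ l, ip (K (V l) - qform su2Rep β (v l) (v l) • V l) (K (V l) - qform su2Rep β (v l) (v l) • V l) ≤ ρ := by
    intro l
    rw [hip, l2Form_apply, hK, coe_residual]
    refine (hres l).trans ?_
    rw [hρdef, hR0]
    exact mul_le_mul_of_nonneg_right (mul_le_mul_of_nonneg_right hCC' hx3) (sq_nonneg _)
  -- one-site values are non-negative
  have hμ : ∀ j : ℕ, 0 ≤ levelValue su2Rep 1 (oneSiteCoupling β L) j := fun j =>
    levelValue_su2Rep_nonneg 1 (oneSiteCoupling_nonneg β L) j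
  -- the witnesses
  refine ⟨fun i => (u i : GaugeConfig 3 L Theorems.FemtoTransferGap.SU2 → ℝ), fun i => isPhys_coe (u i), hon, ?_, ?_, ?_, ?_, ?_⟩
  · intro i l hil
    rw [hdiag, if_neg hil]
  · intro i l hil
    rw [hq, hq]
    exact hanti hil
  · intro j
    obtain ⟨h1, h2⟩ := hritz j (Nat.le_of_lt_succ j.2)
    rw [hRj, hR0] at h1 h2
    rw [hq, hq]
    exact ⟨le_exp_mul_div_of_le h1 hs0 (mul_nonneg (hμ j) (hm0 0)) hCCD,
      le_exp_mul_div_of_le h2 hs0 (mul_nonneg (hm0 j) (hμ 0)) hCCD⟩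
  · intro c
    simp_rw [hq]
    rw [← coe_sum_smul_residual β u m c, ← l2Form_apply]
    have hA := residualGram_le_of_generators ip hip_symm hip_nonneg K hKsymm V (fun l => qform su2Rep β (v l) (v l)) u m
      hon' hritz' hu' hvu (by norm_num : (0 : ℝ) < 1 / 2) hρ0 hgram' hres' c
    refine hA.trans (le_of_eq ?_)
    rw [hρdef]
    push_cast
    ring
  · intro ψ hψ
    rw [hq, ← hR0]
    exact htop ψ hψ

/-! ## §4 The converse `DressedRitz → RitzGenerators` and the equivalence -/

/-- **A dressed Ritz family is a generator family** (orthonormal ⇒ Gram `= 1`; the residual Gram bound at `c = e_i` is the per-generator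
residual bound; `ritzValue β φ j = m_j` by in-span Courant–Fischer). -/
theorem ritzGenerators_of_dressedRitz (h : DressedRitz) : RitzGenerators := by
  intro k η hη
  obtain ⟨C, lam0, hlam0, hC⟩ := h k η hη
  refine ⟨C, lam0, hlam0, fun lam hlam hle => ?_⟩
  obtain ⟨L0, hL0⟩ := hC lam hlam hle
  refine ⟨L0, fun L _ hL β hW => ?_⟩
  obtain ⟨φ, hphys, hon, hoff, hanti, hratio, hres, htop⟩ := hL0 L hL β hW
  have hβ1 : (1 : ℝ) ≤ β := hW.1
  have hβ0 : (0 : ℝ) ≤ β := zero_le_one.trans hβ1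
  -- packaged family, diagonal data
  let U : Fin (k + 1) → physSubmodule L := fun i => ⟨φ i, hphys i⟩
  set m : Fin (k + 1) → ℝ := fun i => qform su2Rep β (φ i) (φ i) with hmdef
  have hu : ∀ i, (U i : GaugeConfig 3 L Theorems.FemtoTransferGap.SU2 → ℝ) ∈ Submodule.span ℝ (Set.range φ) := fun i =>
    Submodule.subset_span ⟨i, rfl⟩
  have honU : ∀ i l, l2 (U i : GaugeConfig 3 L Theorems.FemtoTransferGap.SU2 → ℝ) (U l) = if i = l then 1 else 0 := hon
  have hdiag : ∀ i l, qform su2Rep β (U i : GaugeConfig 3 L Theorems.FemtoTransferGap.SU2 → ℝ) (U l) = if i = l then m i else 0 := by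
    intro i l
    by_cases hil : i = l
    · subst hil; simp [hmdef, U]
    · rw [if_neg hil]; exact hoff i l hil
  have hantim : Antitone m := fun i l hil => hanti i l hil
  have hRj : ∀ (j : ℕ) (hj : j ≤ k), ritzValue β φ j = m ⟨j, Nat.lt_succ_of_le hj⟩ := fun j hj =>
    ritzValue_eq_ritzDiag hβ0 hphys hu honU hdiag hantim hj
  have hR0 : ritzValue β φ 0 = m 0 := hRj 0 (Nat.zero_le k)
  have hm0eq : m 0 = qform su2Rep β (φ 0) (φ 0) := rfl
  refine ⟨φ, hphys, fun i => by rw [hon, if_pos rfl], ?_, ?_, ?_, ?_⟩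
  · -- (g1): `‖Σ c_i φ_i‖² = Σ c_i²`
    intro c
    have hcoe : (∑ i, c i • φ i) = ((∑ i, c i • U i : physSubmodule L) : GaugeConfig 3 L Theorems.FemtoTransferGap.SU2 → ℝ) := by
      rw [coe_sum_smul]
    have hval : l2 (∑ i, c i • φ i) (∑ i, c i • φ i) = ∑ i, c i ^ 2 := by
      rw [hcoe, ← l2Form_apply, bilin_sum_smul_sum_smul]
      refine Finset.sum_congr rfl fun i _ => ?_
      simp only [l2Form_apply, honU, mul_ite, mul_one, mul_zero, Finset.sum_ite_eq, Finset.mem_univ, if_true]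
      ring
    rw [hval]
    have : 0 ≤ ∑ i, c i ^ 2 := Finset.sum_nonneg fun i _ => sq_nonneg (c i)
    linarith
  · -- (g2): the residual Gram bound at `c = e_i`
    intro i
    classical
    have h := hres (fun l => if l = i then 1 else 0)
    have hsum : (∑ l, (fun l => if l = i then (1 : ℝ) else 0) l •
        (transferApply β (φ l) - qform su2Rep β (φ l) (φ l) • φ l)) =
        transferApply β (φ i) - qform su2Rep β (φ i) (φ i) • φ i := by
      simp only [ite_smul, one_smul, zero_smul, Finset.sum_ite_eq', Finset.mem_univ, if_true]
    have hsq : (∑ l, ((fun l => if l = i then (1 : ℝ) else 0) l) ^ 2) = 1 := by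
      rw [Finset.sum_eq_single i]
      · simp
      · intro l _ hli; simp [hli]
      · intro hi; exact absurd (Finset.mem_univ i) hi
    rw [hsum, hsq, mul_one] at h
    rw [hR0, hm0eq]
    exact h
  · -- (g3)
    intro j hj
    obtain ⟨h1, h2⟩ := hratio ⟨j, Nat.lt_succ_of_le hj⟩
    rw [hRj j hj, hR0, hm0eq]
    exact ⟨h1, h2⟩
  · -- (g4)
    intro ψ hψ
    rw [hR0, hm0eq]
    exact htop ψ hψ

/-- **`RitzGenerators ↔ DressedRitz`.** -/
theorem ritzGenerators_iff_dressedRitz : RitzGenerators ↔ DressedRitz :=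
  ⟨dressedRitz_of_ritzGenerators, ritzGenerators_of_dressedRitz⟩


/-! ## §5  LEMMA B, arithmetic core — quadratic forms with near-diagonal data (index-generic, operator-free)

For a coefficient vector `b`, "matrices" `A G : ι → ι → ℝ` with `|G_il − δ_il| ≤ ε` and SYMMETRISED couplings
`|A_il − ½(d_i + d_l) G_il| ≤ τ` (both for ALL `(i,l)`; on the diagonal they say `G_ii = 1`, `A_ii = d_i` up to the
tolerances), the quadratic form `Σ_i Σ_l b_i b_l (A_il − t G_il)` differs from its diagonal model `Σ_i (d_i − t) b_i²` by at
most `τ B² + ε B Σ_i |d_i − t| |b_i|`, `B = Σ|b_i|` (`quadForm_sub_diag_abs_le`).  Completing the square index by index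
then gives a LOWER bound when all `d_i − t ≥ 0` and an UPPER bound when the coefficients at indices with `d_i − t > 0` are
`≤ εB` (which is what `ip`-orthogonality constraints force) — both SECOND order in `ε`. -/

section LemmaBCore

variable {ι : Type*} [Fintype ι] [DecidableEq ι]

omit [DecidableEq ι] in
/-- Cauchy–Schwarz: `(Σ|b_i|)² ≤ card ι · Σ b_i²`. -/
theorem sq_sum_abs_le_card_mul_sum_sq (b : ι → ℝ) :
    (∑ i, |b i|) ^ 2 ≤ (Fintype.card ι : ℝ) * ∑ i, b i ^ 2 := by
  have h := Finset.sum_mul_sq_le_sq_mul_sq (Finset.univ : Finset ι) (fun _ => (1 : ℝ)) (fun i => |b i|)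
  simpa only [one_mul, one_pow, Finset.sum_const, Finset.card_univ, nsmul_eq_mul, mul_one, sq_abs] using h

/-- **(★) diagonal approximation of a quadratic form with near-diagonal data.** -/
theorem quadForm_sub_diag_abs_le (A G : ι → ι → ℝ) (d b : ι → ℝ) (t ε τ : ℝ)
    (hG : ∀ i l, |G i l - (if i = l then 1 else 0)| ≤ ε)
    (hS : ∀ i l, |A i l - (d i + d l) / 2 * G i l| ≤ τ) :
    |∑ i, ∑ l, b i * b l * (A i l - t * G i l) - ∑ i, (d i - t) * b i ^ 2|
      ≤ τ * (∑ i, |b i|) ^ 2 + ε * (∑ i, |b i|) * ∑ i, |d i - t| * |b i| := by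
  -- pointwise splitting of the summand
  have key : ∀ i l, b i * b l * (A i l - t * G i l)
      = (b i * b l * (A i l - (d i + d l) / 2 * G i l)
          + b i * b l * (((d i - t) + (d l - t)) / 2) * (G i l - (if i = l then 1 else 0)))
        + (if i = l then ((d i - t) + (d l - t)) / 2 * (b i * b l) else 0) := by
    intro i l; split_ifs <;> ring
  have hdiag : ∑ i, ∑ l, (if i = l then ((d i - t) + (d l - t)) / 2 * (b i * b l) else 0)
      = ∑ i, (d i - t) * b i ^ 2 := by
    refine Finset.sum_congr rfl fun i _ => ?_
    rw [Finset.sum_ite_eq]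
    simp only [Finset.mem_univ, if_true]
    ring
  have hrew : ∑ i, ∑ l, b i * b l * (A i l - t * G i l) - ∑ i, (d i - t) * b i ^ 2
      = ∑ i, ∑ l, (b i * b l * (A i l - (d i + d l) / 2 * G i l)
          + b i * b l * (((d i - t) + (d l - t)) / 2) * (G i l - (if i = l then 1 else 0))) := by
    rw [← hdiag, ← Finset.sum_sub_distrib]
    refine Finset.sum_congr rfl fun i _ => ?_
    rw [← Finset.sum_sub_distrib]
    refine Finset.sum_congr rfl fun l _ => ?_
    rw [key i l]; ring
  rw [hrew]
  -- termwise absolute values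
  have hterm : ∀ i l, |b i * b l * (A i l - (d i + d l) / 2 * G i l)
          + b i * b l * (((d i - t) + (d l - t)) / 2) * (G i l - (if i = l then 1 else 0))|
      ≤ τ * (|b i| * |b l|)
        + ((ε / 2) * ((|d i - t| * |b i|) * |b l|) + (ε / 2) * (|b i| * (|d l - t| * |b l|))) := by
    intro i l
    have hbb : 0 ≤ |b i| * |b l| := mul_nonneg (abs_nonneg _) (abs_nonneg _)
    have h1 : |b i * b l * (A i l - (d i + d l) / 2 * G i l)| ≤ τ * (|b i| * |b l|) := by
      rw [abs_mul, abs_mul]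
      calc |b i| * |b l| * |A i l - (d i + d l) / 2 * G i l| ≤ |b i| * |b l| * τ :=
            mul_le_mul_of_nonneg_left (hS i l) hbb
        _ = τ * (|b i| * |b l|) := by ring
    have ha : |((d i - t) + (d l - t)) / 2| ≤ (|d i - t| + |d l - t|) / 2 := by
      rw [abs_div, abs_two]
      exact div_le_div_of_nonneg_right (abs_add_le _ _) zero_le_two
    have h2 : |b i * b l * (((d i - t) + (d l - t)) / 2) * (G i l - (if i = l then 1 else 0))|
        ≤ (|b i| * |b l|) * ((|d i - t| + |d l - t|) / 2) * ε := by
      rw [abs_mul, abs_mul, abs_mul]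
      apply mul_le_mul _ (hG i l) (abs_nonneg _) (mul_nonneg hbb (by positivity))
      exact mul_le_mul_of_nonneg_left ha hbb
    calc _ ≤ |b i * b l * (A i l - (d i + d l) / 2 * G i l)|
            + |b i * b l * (((d i - t) + (d l - t)) / 2) * (G i l - (if i = l then 1 else 0))| := abs_add_le _ _
      _ ≤ τ * (|b i| * |b l|) + (|b i| * |b l|) * ((|d i - t| + |d l - t|) / 2) * ε := add_le_add h1 h2
      _ = _ := by ring
  -- sum up
  calc |∑ i, ∑ l, (b i * b l * (A i l - (d i + d l) / 2 * G i l)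
          + b i * b l * (((d i - t) + (d l - t)) / 2) * (G i l - (if i = l then 1 else 0)))|
      ≤ ∑ i, |∑ l, (b i * b l * (A i l - (d i + d l) / 2 * G i l)
          + b i * b l * (((d i - t) + (d l - t)) / 2) * (G i l - (if i = l then 1 else 0)))| :=
        Finset.abs_sum_le_sum_abs _ _
    _ ≤ ∑ i, ∑ l, (τ * (|b i| * |b l|)
        + ((ε / 2) * ((|d i - t| * |b i|) * |b l|) + (ε / 2) * (|b i| * (|d l - t| * |b l|)))) := by
        refine Finset.sum_le_sum fun i _ => (Finset.abs_sum_le_sum_abs _ _).trans ?_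
        exact Finset.sum_le_sum fun l _ => hterm i l
    _ = τ * (∑ i, |b i|) ^ 2 + ε * (∑ i, |b i|) * ∑ i, |d i - t| * |b i| := by
        simp only [Finset.sum_add_distrib, ← Finset.mul_sum, ← Finset.sum_mul]
        ring

/-- **LOWER bound** (all `d_i − t ≥ 0`): second order in `ε`. -/
theorem quadForm_lower_of_nonneg (A G : ι → ι → ℝ) (d b : ι → ℝ) (t ε τ σ : ℝ)
    (hG : ∀ i l, |G i l - (if i = l then 1 else 0)| ≤ ε)
    (hS : ∀ i l, |A i l - (d i + d l) / 2 * G i l| ≤ τ)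
    (ha : ∀ i, 0 ≤ d i - t) (hσ : ∀ i, d i - t ≤ σ) :
    -((τ + ε ^ 2 * σ * (Fintype.card ι : ℝ) / 4) * (∑ i, |b i|) ^ 2)
      ≤ ∑ i, ∑ l, b i * b l * (A i l - t * G i l) := by
  have h := (abs_le.mp (quadForm_sub_diag_abs_le A G d b t ε τ hG hS)).1
  set B : ℝ := ∑ i, |b i| with hB
  have hB0 : 0 ≤ B := Finset.sum_nonneg fun i _ => abs_nonneg (b i)
  -- complete the square index by index
  have hi : ∀ i, -(σ * (ε ^ 2 * B ^ 2 / 4)) ≤ (d i - t) * b i ^ 2 - ε * B * (|d i - t| * |b i|) := by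
    intro i
    rw [abs_of_nonneg (ha i), ← sq_abs (b i)]
    have hsq : 0 ≤ (d i - t) * (|b i| - ε * B / 2) ^ 2 := mul_nonneg (ha i) (sq_nonneg _)
    have hq : 0 ≤ ε ^ 2 * B ^ 2 / 4 := by positivity
    nlinarith [hsq, mul_le_mul_of_nonneg_right (hσ i) hq]
  have hsum : -((Fintype.card ι : ℝ) * (σ * (ε ^ 2 * B ^ 2 / 4)))
      ≤ ∑ i, ((d i - t) * b i ^ 2 - ε * B * (|d i - t| * |b i|)) := by
    have := Finset.sum_le_sum fun i (_ : i ∈ Finset.univ) => hi i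
    rw [Finset.sum_const, Finset.card_univ, nsmul_eq_mul] at this
    linarith
  have hsplit : ∑ i, ((d i - t) * b i ^ 2 - ε * B * (|d i - t| * |b i|))
      = ∑ i, (d i - t) * b i ^ 2 - ε * B * ∑ i, |d i - t| * |b i| := by
    simp only [Finset.sum_sub_distrib, ← Finset.mul_sum]
  rw [hsplit] at hsum
  nlinarith [hsum, h]

/-- **UPPER bound** (coefficients at indices with `d_i − t > 0` are `≤ εB`): second order in `ε`. -/
theorem quadForm_upper_of_constraints (A G : ι → ι → ℝ) (d b : ι → ℝ) (t ε τ σ : ℝ) (hε : 0 ≤ ε)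
    (hG : ∀ i l, |G i l - (if i = l then 1 else 0)| ≤ ε)
    (hS : ∀ i l, |A i l - (d i + d l) / 2 * G i l| ≤ τ)
    (hσ : ∀ i, |d i - t| ≤ σ)
    (hcons : ∀ i, 0 < d i - t → |b i| ≤ ε * ∑ l, |b l|) :
    ∑ i, ∑ l, b i * b l * (A i l - t * G i l)
      ≤ (τ + 2 * σ * ε ^ 2 * (Fintype.card ι : ℝ)) * (∑ i, |b i|) ^ 2 := by
  have h := (abs_le.mp (quadForm_sub_diag_abs_le A G d b t ε τ hG hS)).2
  set B : ℝ := ∑ i, |b i| with hB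
  have hB0 : 0 ≤ B := Finset.sum_nonneg fun i _ => abs_nonneg (b i)
  have hεB : 0 ≤ ε * B := mul_nonneg hε hB0
  have hi : ∀ i, (d i - t) * b i ^ 2 + ε * B * (|d i - t| * |b i|) ≤ 2 * σ * (ε ^ 2 * B ^ 2) := by
    intro i
    have hσi := hσ i
    have hσ0 : 0 ≤ σ := (abs_nonneg _).trans hσi
    rw [← sq_abs (b i)]
    rcases lt_or_ge 0 (d i - t) with hpos | hnp
    · -- constrained index: `|b_i| ≤ εB`
      have hb := hcons i hpos
      have hdi : d i - t ≤ σ := (le_abs_self _).trans hσi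
      rw [abs_of_pos hpos]
      have h1 : |b i| ^ 2 ≤ (ε * B) ^ 2 := pow_le_pow_left₀ (abs_nonneg _) hb 2
      have h2 : (d i - t) * |b i| ^ 2 ≤ σ * (ε * B) ^ 2 :=
        mul_le_mul hdi h1 (sq_nonneg _) hσ0
      have h3 : ε * B * ((d i - t) * |b i|) ≤ ε * B * (σ * (ε * B)) :=
        mul_le_mul_of_nonneg_left (mul_le_mul hdi hb (abs_nonneg _) hσ0) hεB
      nlinarith [h2, h3]
    · -- unconstrained index with `d_i − t ≤ 0`: complete the square
      rw [abs_of_nonpos hnp]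
      have hsq : 0 ≤ (t - d i) * (|b i| - ε * B / 2) ^ 2 := mul_nonneg (by linarith) (sq_nonneg _)
      have hdi : t - d i ≤ σ := by
        have := neg_abs_le (d i - t); linarith
      have hq : 0 ≤ ε ^ 2 * B ^ 2 / 4 := by positivity
      nlinarith [hsq, mul_le_mul_of_nonneg_right hdi hq, hσ0, hq]
  have hsum : ∑ i, ((d i - t) * b i ^ 2 + ε * B * (|d i - t| * |b i|))
      ≤ (Fintype.card ι : ℝ) * (2 * σ * (ε ^ 2 * B ^ 2)) := by
    have := Finset.sum_le_sum fun i (_ : i ∈ Finset.univ) => hi i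
    simpa only [Finset.sum_const, Finset.card_univ, nsmul_eq_mul] using this
  have hsplit : ∑ i, ((d i - t) * b i ^ 2 + ε * B * (|d i - t| * |b i|))
      = ∑ i, (d i - t) * b i ^ 2 + ε * B * ∑ i, |d i - t| * |b i| := by
    simp only [Finset.sum_add_distrib, ← Finset.mul_sum]
  rw [hsplit] at hsum
  nlinarith [hsum, h]

/-- Gram lower bound: `Σ_i Σ_l b_i b_l G_il ≥ (1 − card·ε) Σ b_i²`. -/
theorem gram_lower (G : ι → ι → ℝ) (b : ι → ℝ) (ε : ℝ) (hε : 0 ≤ ε)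
    (hG : ∀ i l, |G i l - (if i = l then 1 else 0)| ≤ ε) :
    (1 - (Fintype.card ι : ℝ) * ε) * ∑ i, b i ^ 2 ≤ ∑ i, ∑ l, b i * b l * G i l := by
  have hsplit : ∑ i, ∑ l, b i * b l * G i l
      = ∑ i, b i ^ 2 + ∑ i, ∑ l, b i * b l * (G i l - (if i = l then 1 else 0)) := by
    rw [← Finset.sum_add_distrib]
    refine Finset.sum_congr rfl fun i _ => ?_
    have : ∑ l, b i * b l * (G i l - (if i = l then 1 else 0))
        = ∑ l, b i * b l * G i l - ∑ l, (if i = l then b i * b l else 0) := by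
      rw [← Finset.sum_sub_distrib]
      refine Finset.sum_congr rfl fun l _ => ?_
      split_ifs <;> ring
    rw [this, Finset.sum_ite_eq]
    simp only [Finset.mem_univ, if_true]
    ring
  have habs : |∑ i, ∑ l, b i * b l * (G i l - (if i = l then 1 else 0))| ≤ ε * (∑ i, |b i|) ^ 2 := by
    calc _ ≤ ∑ i, |∑ l, b i * b l * (G i l - (if i = l then 1 else 0))| := Finset.abs_sum_le_sum_abs _ _
      _ ≤ ∑ i, ∑ l, ε * (|b i| * |b l|) := by
          refine Finset.sum_le_sum fun i _ => (Finset.abs_sum_le_sum_abs _ _).trans ?_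
          refine Finset.sum_le_sum fun l _ => ?_
          rw [abs_mul, abs_mul]
          calc |b i| * |b l| * |G i l - (if i = l then 1 else 0)| ≤ |b i| * |b l| * ε :=
                mul_le_mul_of_nonneg_left (hG i l) (mul_nonneg (abs_nonneg _) (abs_nonneg _))
            _ = ε * (|b i| * |b l|) := by ring
      _ = ε * (∑ i, |b i|) ^ 2 := by
          simp only [← Finset.mul_sum, ← Finset.sum_mul]
          ring
  have hcs := sq_sum_abs_le_card_mul_sum_sq b
  have h1 := (abs_le.mp habs).1
  rw [hsplit]
  nlinarith [h1, hcs, mul_le_mul_of_nonneg_left hcs hε]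

/-- Constraint ⇒ small coefficient: if `Σ_l G_il b_l = 0` then `|b_i| ≤ ε Σ|b_l|`. -/
theorem abs_coeff_le_of_constraint (G : ι → ι → ℝ) (b : ι → ℝ) (ε : ℝ)
    (hG : ∀ i l, |G i l - (if i = l then 1 else 0)| ≤ ε) (i : ι)
    (hcon : ∑ l, G i l * b l = 0) : |b i| ≤ ε * ∑ l, |b l| := by
  have hbi : b i = ∑ l, ((if i = l then 1 else 0) - G i l) * b l := by
    have : ∑ l, ((if i = l then 1 else 0) - G i l) * b l
        = ∑ l, (if i = l then b l else 0) - ∑ l, G i l * b l := by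
      rw [← Finset.sum_sub_distrib]
      refine Finset.sum_congr rfl fun l _ => ?_
      split_ifs <;> ring
    rw [this, hcon, sub_zero, Finset.sum_ite_eq]
    simp
  rw [hbi, Finset.mul_sum]
  refine (Finset.abs_sum_le_sum_abs _ _).trans (Finset.sum_le_sum fun l _ => ?_)
  rw [abs_mul, abs_sub_comm]
  exact mul_le_mul_of_nonneg_right (hG i l) (abs_nonneg _)

end LemmaBCore

/-! ## §6  LEMMA B — Ritz values from near-diagonal generator data (abstract real vector space)

`ritz_near_diagonal`: unit generators `v_0 … v_{n−1}` with antitone diagonal data `d_i = E(v_i,v_i)`, near-orthogonality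
`|ip(v_i,v_l)| ≤ ε` and symmetrised couplings `|E(v_i,v_l) − ½(d_i+d_l)·ip(v_i,v_l)| ≤ τ` (`i ≠ l`), spread `|d_i − d_l| ≤ σ`;
`u, m` ANY `ip`-orthonormal `E`-diagonal antitone basis of the same span (the Ritz basis; `m_j` = the in-span min–max values).
Then `|m_j − d_j| ≤ (nτ + 2n²σε²)/(1 − nε)` — first order in `τ`, SECOND order in `ε`, no cluster structure or gaps needed.
Upper half: `exists_rayleigh_ge_of_constraints` (lit) with the constraints `ip(v_i,·)`, `i < j`, + `quadForm_upper_of_constraints`;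
lower half: a kernel vector in `span{v_0..v_j}` killing `ip(u_i,·)`, `i < j`, + `rayleigh_le_of_mem_span_of_orthogonal` (lit)
+ `quadForm_lower_of_nonneg`. -/

section LemmaB

variable {D : Type*} [AddCommGroup D] [Module ℝ D]

set_option maxHeartbeats 800000 in
/-- **LEMMA B (Ritz values from near-diagonal data, second order).** -/
theorem ritz_near_diagonal (ip E : D →ₗ[ℝ] D →ₗ[ℝ] ℝ)
    {n : ℕ} (v : Fin n → D) (d : Fin n → ℝ) (hd : ∀ i, E (v i) (v i) = d i) (hd_anti : Antitone d)
    (hunit : ∀ i, ip (v i) (v i) = 1) {ε τ σ : ℝ} (hε : 0 ≤ ε) (hτ : 0 ≤ τ) (hnε : (n : ℝ) * ε < 1)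
    (hG : ∀ i l, i ≠ l → |ip (v i) (v l)| ≤ ε)
    (hS : ∀ i l, i ≠ l → |E (v i) (v l) - (d i + d l) / 2 * ip (v i) (v l)| ≤ τ)
    (hσ : ∀ i l, |d i - d l| ≤ σ)
    (u : Fin n → D) (m : Fin n → ℝ) (hm : Antitone m)
    (huv : ∀ i, u i ∈ Submodule.span ℝ (Set.range v)) (hvu : ∀ i, v i ∈ Submodule.span ℝ (Set.range u))
    (hon : ∀ i l, ip (u i) (u l) = if i = l then 1 else 0)
    (hdiag : ∀ i l, E (u i) (u l) = if i = l then m i else 0) (j : Fin n) :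
    |m j - d j| ≤ ((n : ℝ) * τ + 2 * (n : ℝ) ^ 2 * σ * ε ^ 2) / (1 - (n : ℝ) * ε) := by
  classical
  -- all-(i,l) forms of the tolerances
  have hG' : ∀ i l, |ip (v i) (v l) - (if i = l then 1 else 0)| ≤ ε := by
    intro i l
    by_cases hil : i = l
    · subst hil; simp [hunit, hε]
    · simpa [hil] using hG i l hil
  have hS' : ∀ i l, |E (v i) (v l) - (d i + d l) / 2 * ip (v i) (v l)| ≤ τ := by
    intro i l
    by_cases hil : i = l
    · subst hil; rw [hd, hunit]; ring_nf; simpa using hτ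
    · exact hS i l hil
  have hσ0 : 0 ≤ σ := by simpa using hσ j j
  set θ : ℝ := 1 - (n : ℝ) * ε with hθ
  have hθ0 : 0 < θ := by rw [hθ]; linarith
  set δ : ℝ := (n : ℝ) * τ + 2 * (n : ℝ) ^ 2 * σ * ε ^ 2 with hδ
  have hδ0 : 0 ≤ δ := by rw [hδ]; positivity
  have hjn : (j : ℕ) < n := j.isLt
  have hspan_uv : Submodule.span ℝ (Set.range u) ≤ Submodule.span ℝ (Set.range v) :=
    Submodule.span_le.mpr (Set.range_subset_iff.mpr huv)
  have hspan_vu : Submodule.span ℝ (Set.range v) ≤ Submodule.span ℝ (Set.range u) :=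
    Submodule.span_le.mpr (Set.range_subset_iff.mpr hvu)
  rw [abs_le]
  constructor
  · ------------------------------------------------------------------ LOWER: m_j ≥ d_j − δ/θ
    -- the first `j+1` generators
    have hjn1 : (j : ℕ) + 1 ≤ n := hjn
    set w : Fin ((j : ℕ) + 1) → D := fun k => v (Fin.castLE hjn1 k) with hw
    -- a non-trivial combination annihilated by `ip(u_i, ·)`, `i < j`
    have hker : LinearMap.ker (Matrix.mulVecLin
        (Matrix.of fun (l : Fin (j : ℕ)) (k : Fin ((j : ℕ) + 1)) =>
          ip (u (Fin.castLE (le_of_lt hjn) l)) (w k))) ≠ ⊥ := by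
      apply LinearMap.ker_ne_bot_of_finrank_lt
      simp only [Module.finrank_fin_fun]
      omega
    obtain ⟨g, hg, hg0⟩ := (Submodule.ne_bot_iff _).mp hker
    rw [LinearMap.mem_ker, Matrix.mulVecLin_apply] at hg
    set x₀ : D := ∑ k, g k • w k with hx₀
    have hperp0 : ∀ l : Fin (j : ℕ), ip (u (Fin.castLE (le_of_lt hjn) l)) x₀ = 0 := by
      intro l
      have h := congr_fun hg l
      rw [Pi.zero_apply, Matrix.mulVec, dotProduct] at h
      rw [hx₀, map_sum]
      simp only [map_smul, smul_eq_mul]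
      calc ∑ k, g k * ip (u (Fin.castLE (le_of_lt hjn) l)) (w k)
          = ∑ k, (Matrix.of fun (l : Fin (j : ℕ)) (k : Fin ((j : ℕ) + 1)) =>
              ip (u (Fin.castLE (le_of_lt hjn) l)) (w k)) l k * g k := by
            refine Finset.sum_congr rfl fun k _ => ?_
            rw [Matrix.of_apply]; ring
        _ = 0 := h
    have hperp : ∀ i : Fin n, i.val < (j : ℕ) → ip (u i) x₀ = 0 := by
      intro i hi
      have h := hperp0 ⟨i.val, hi⟩
      have : Fin.castLE (le_of_lt hjn) ⟨i.val, hi⟩ = i := Fin.ext rfl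
      rwa [this] at h
    have hx₀v : x₀ ∈ Submodule.span ℝ (Set.range v) := by
      refine Submodule.sum_mem _ fun k _ => Submodule.smul_mem _ _ ?_
      exact Submodule.subset_span (Set.mem_range_self _)
    have hx₀u : x₀ ∈ Submodule.span ℝ (Set.range u) := hspan_vu hx₀v
    -- u-side: E(x₀,x₀) ≤ m_j · ip(x₀,x₀)
    have hup : E x₀ x₀ ≤ m j * ip x₀ x₀ :=
      rayleigh_le_of_mem_span_of_orthogonal ip E u m hon hdiag
        (fun i hi => hm (show j ≤ i from Fin.le_def.mpr hi)) hx₀u hperp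
    -- v-side data for the subfamily `w`
    have hip₀ : ip x₀ x₀ = ∑ k, ∑ k', g k * g k' * ip (w k) (w k') := by
      rw [hx₀, bilin_sum_smul_sum_smul]
    have hE₀ : E x₀ x₀ = ∑ k, ∑ k', g k * g k' * E (w k) (w k') := by
      rw [hx₀, bilin_sum_smul_sum_smul]
    have hGw : ∀ k k', |ip (w k) (w k') - (if k = k' then 1 else 0)| ≤ ε := by
      intro k k'
      have := hG' (Fin.castLE hjn1 k) (Fin.castLE hjn1 k')
      simpa only [hw, (Fin.castLE_injective hjn1).eq_iff] using this
    have hSw : ∀ k k', |E (w k) (w k') - (d (Fin.castLE hjn1 k) + d (Fin.castLE hjn1 k')) / 2 * ip (w k) (w k')| ≤ τ :=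
      fun k k' => hS' _ _
    have haw : ∀ k, 0 ≤ d (Fin.castLE hjn1 k) - d j := by
      intro k
      have hk : Fin.castLE hjn1 k ≤ j := by
        rw [Fin.le_def]; simpa [Fin.val_castLE] using Nat.lt_succ_iff.mp k.isLt
      linarith [hd_anti hk]
    have hσw : ∀ k, d (Fin.castLE hjn1 k) - d j ≤ σ := fun k => (le_abs_self _).trans (hσ _ _)
    have hlow := quadForm_lower_of_nonneg (fun k k' => E (w k) (w k')) (fun k k' => ip (w k) (w k'))
      (fun k => d (Fin.castLE hjn1 k)) g (d j) ε τ σ hGw hSw haw hσw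
    have hgram := gram_lower (fun k k' => ip (w k) (w k')) g ε hε hGw
    have hcs := sq_sum_abs_le_card_mul_sum_sq g
    simp only [Fintype.card_fin] at hlow hgram hcs
    -- the quadratic form with `t = d_j` is `E₀ − d_j ip₀`
    have hX : ∑ k, ∑ k', g k * g k' * (E (w k) (w k') - d j * ip (w k) (w k'))
        = E x₀ x₀ - d j * ip x₀ x₀ := by
      rw [hE₀, hip₀, Finset.mul_sum, ← Finset.sum_sub_distrib]
      refine Finset.sum_congr rfl fun k _ => ?_
      rw [Finset.mul_sum, ← Finset.sum_sub_distrib]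
      refine Finset.sum_congr rfl fun k' _ => ?_
      ring
    rw [hX] at hlow
    rw [← hip₀] at hgram
    -- positivity of `Σ g_k²`
    have hgpos : 0 < ∑ k, g k ^ 2 := by
      obtain ⟨k, hk⟩ : ∃ k, g k ≠ 0 := by
        by_contra h
        push Not at h
        exact hg0 (funext fun k => by rw [h k, Pi.zero_apply])
      exact lt_of_lt_of_le (by positivity) (Finset.single_le_sum (fun k _ => sq_nonneg (g k)) (Finset.mem_univ k))
    -- sizes: (j+1) ≤ n
    have hj1n : ((j : ℕ) + 1 : ℝ) ≤ n := by exact_mod_cast hjn1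
    have hj1 : (0 : ℝ) ≤ ((j : ℕ) + 1 : ℝ) := by positivity
    have hθj : θ ≤ 1 - ((j : ℕ) + 1 : ℝ) * ε := by
      rw [hθ]; nlinarith [mul_le_mul_of_nonneg_right hj1n hε]
    -- ip₀ ≥ θ Σ g² > 0
    have hipθ : θ * ∑ k, g k ^ 2 ≤ ip x₀ x₀ := by
      have := mul_le_mul_of_nonneg_right hθj hgpos.le
      push_cast at hgram this ⊢
      linarith
    have hippos : 0 < ip x₀ x₀ := lt_of_lt_of_le (mul_pos hθ0 hgpos) hipθ
    -- the error term is ≤ δ Σ g² ≤ (δ/θ) ip₀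
    have hB2 : (∑ k, |g k|) ^ 2 ≤ (n : ℝ) * ∑ k, g k ^ 2 := by
      push_cast at hcs
      exact hcs.trans (mul_le_mul_of_nonneg_right hj1n hgpos.le)
    have herr : (τ + ε ^ 2 * σ * ((j : ℕ) + 1 : ℝ) / 4) * (∑ k, |g k|) ^ 2 ≤ δ * ∑ k, g k ^ 2 := by
      have hc1 : τ + ε ^ 2 * σ * ((j : ℕ) + 1 : ℝ) / 4 ≤ τ + 2 * (n : ℝ) * σ * ε ^ 2 := by
        nlinarith [mul_le_mul_of_nonneg_right hj1n (show 0 ≤ ε ^ 2 * σ by positivity), show (0:ℝ) ≤ n * (ε ^ 2 * σ) by positivity]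
      have hc0 : 0 ≤ τ + ε ^ 2 * σ * ((j : ℕ) + 1 : ℝ) / 4 := by positivity
      calc _ ≤ (τ + 2 * (n : ℝ) * σ * ε ^ 2) * (∑ k, |g k|) ^ 2 := mul_le_mul_of_nonneg_right hc1 (sq_nonneg _)
        _ ≤ (τ + 2 * (n : ℝ) * σ * ε ^ 2) * ((n : ℝ) * ∑ k, g k ^ 2) :=
            mul_le_mul_of_nonneg_left hB2 (by positivity)
        _ = δ * ∑ k, g k ^ 2 := by rw [hδ]; ring
    have herr' : δ * ∑ k, g k ^ 2 ≤ δ / θ * ip x₀ x₀ := by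
      rw [div_mul_eq_mul_div, le_div_iff₀ hθ0]
      calc (δ * ∑ k, g k ^ 2) * θ = δ * (θ * ∑ k, g k ^ 2) := by ring
        _ ≤ δ * ip x₀ x₀ := mul_le_mul_of_nonneg_left hipθ hδ0
    push_cast at hlow
    -- combine: (m_j − d_j + δ/θ) ip₀ ≥ 0
    have hkey : 0 ≤ (m j - d j + δ / θ) * ip x₀ x₀ := by nlinarith [hlow, hup, herr, herr']
    have := (mul_nonneg_iff_of_pos_right hippos).mp hkey
    linarith
  · ------------------------------------------------------------------ UPPER: m_j ≤ d_j + δ/θ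
    -- u-side: a unit vector of span{u_0..u_j} orthogonal to v_0..v_{j-1} with E ≥ m_j
    obtain ⟨x, hxu, hx1, hxperp, hmE⟩ := exists_rayleigh_ge_of_constraints ip E u m hon hdiag hjn
      (mlo := m j) (fun i hi => hm (show i ≤ j from Fin.le_def.mpr hi))
      (fun l : Fin (j : ℕ) => ip (v (Fin.castLE (le_of_lt hjn) l)))
    have hxv : x ∈ Submodule.span ℝ (Set.range v) := hspan_uv hxu
    obtain ⟨b, hb⟩ := (Submodule.mem_span_range_iff_exists_fun ℝ).mp hxv
    -- v-side data
    have hipx : ip x x = ∑ i, ∑ l, b i * b l * ip (v i) (v l) := by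
      rw [← hb, bilin_sum_smul_sum_smul]
    have hEx : E x x = ∑ i, ∑ l, b i * b l * E (v i) (v l) := by
      rw [← hb, bilin_sum_smul_sum_smul]
    have hcon : ∀ i : Fin n, i.val < (j : ℕ) → ∑ l, ip (v i) (v l) * b l = 0 := by
      intro i hi
      have h := hxperp ⟨i.val, hi⟩
      have hci : Fin.castLE (le_of_lt hjn) ⟨i.val, hi⟩ = i := Fin.ext rfl
      rw [hci, ← hb, bilin_sum_smul_right] at h
      rw [← h]
      exact Finset.sum_congr rfl fun l _ => by ring
    have hcons : ∀ i : Fin n, 0 < d i - d j → |b i| ≤ ε * ∑ l, |b l| := by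
      intro i hi
      have hij : i.val < (j : ℕ) := by
        by_contra hc
        push Not at hc
        have : d i ≤ d j := hd_anti (Fin.le_def.mpr hc)
        linarith
      exact abs_coeff_le_of_constraint (fun i l => ip (v i) (v l)) b ε hG' i (hcon i hij)
    have hupp := quadForm_upper_of_constraints (fun i l => E (v i) (v l)) (fun i l => ip (v i) (v l))
      d b (d j) ε τ σ hε hG' hS' (fun i => hσ i j) hcons
    have hgram := gram_lower (fun i l => ip (v i) (v l)) b ε hε hG'
    have hcs := sq_sum_abs_le_card_mul_sum_sq b
    simp only [Fintype.card_fin] at hupp hgram hcs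
    have hX : ∑ i, ∑ l, b i * b l * (E (v i) (v l) - d j * ip (v i) (v l)) = E x x - d j * ip x x := by
      rw [hEx, hipx, Finset.mul_sum, ← Finset.sum_sub_distrib]
      refine Finset.sum_congr rfl fun i _ => ?_
      rw [Finset.mul_sum, ← Finset.sum_sub_distrib]
      refine Finset.sum_congr rfl fun l _ => ?_
      ring
    rw [hX, hx1, mul_one] at hupp
    rw [← hipx, hx1] at hgram
    -- Σ b² ≤ 1/θ
    have hb2 : θ * ∑ i, b i ^ 2 ≤ 1 := by rw [hθ]; exact hgram
    have hsum0 : 0 ≤ ∑ i, b i ^ 2 := Finset.sum_nonneg fun i _ => sq_nonneg _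
    have herr : (τ + 2 * σ * ε ^ 2 * (n : ℝ)) * (∑ i, |b i|) ^ 2 ≤ δ * ∑ i, b i ^ 2 := by
      calc _ ≤ (τ + 2 * σ * ε ^ 2 * (n : ℝ)) * ((n : ℝ) * ∑ i, b i ^ 2) :=
            mul_le_mul_of_nonneg_left hcs (by positivity)
        _ = δ * ∑ i, b i ^ 2 := by rw [hδ]; ring
    have herr' : δ * ∑ i, b i ^ 2 ≤ δ / θ := by
      rw [le_div_iff₀ hθ0]
      calc (δ * ∑ i, b i ^ 2) * θ = δ * (θ * ∑ i, b i ^ 2) := by ring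
        _ ≤ δ * 1 := mul_le_mul_of_nonneg_left hb2 hδ0
        _ = δ := mul_one δ
    linarith [hmE, hupp, herr, herr']

end LemmaB


/-! ## §7  `DiagonalPlateau` — the GEVP-free typed cut — and `DiagonalPlateau → RitzGenerators`

Every hypothesis of `DiagonalPlateau` is ONE NUMBER per pair of generators and Euclidean time `r ∈ {0,1,2}` (memo §2, §4): unit physical
generators sorted by their diagonal one-step forms `d_i = qform(v_i,v_i)`; near-orthogonality `|l2(v_i,v_l)| ≤ Cλ` (an `O(λ)`-accurate lift);
per-generator one-step residuals `≤ C(λ³/L²)d₀²` (effective-mass plateau); diagonal positions `d_j/d_0` Lüscher to `e^{±Cλ²/L}`; symmetrised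
off-diagonal couplings `≤ C(λ²/L)d₀`; spread `d₀ − d_k ≤ C(λ/L)d₀`; coarse top capture relative to `d₀`.  LEMMA B turns this into (g3), the rest of
`RitzGenerators` is bookkeeping — NO eigenvalue problem is left to the prover of the cut. -/

/-- Pure-real repackaging: additive Ritz errors `|R − d| ≤ δ ≤ C₁·y·d₀` plus the two-sided DIAGONAL position give the two-sided RITZ position with
constant `C + 5C₁` (uses `1 + z ≤ e^z` and `(1 − z)(1 + 2z) ≥ 1` on `[0, 1/2]`; no division). [folklore] -/
theorem twoSided_of_additive {Rj R0 dj d0 μj μ0 δ y C C₁ : ℝ}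
    (hy : 0 ≤ y) (hC₁ : 0 ≤ C₁) (hsmall : 2 * C₁ * y ≤ 1 / 2)
    (hμj : 0 ≤ μj) (hμ0 : 0 ≤ μ0) (hdj : 0 ≤ dj) (hd0 : 0 ≤ d0) (hRj : 0 ≤ Rj)
    (hRdj : |Rj - dj| ≤ δ) (hRd0 : |R0 - d0| ≤ δ) (hδ : δ ≤ C₁ * y * d0) (hd0R0 : d0 ≤ R0)
    (hd0dj : d0 ≤ 2 * dj)
    (h1 : dj * μ0 ≤ Real.exp (C * y) * (μj * d0)) (h2 : μj * d0 ≤ Real.exp (C * y) * (dj * μ0)) :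
    Rj * μ0 ≤ Real.exp ((C + 5 * C₁) * y) * (μj * R0) ∧
      μj * R0 ≤ Real.exp ((C + 5 * C₁) * y) * (Rj * μ0) := by
  have hC₁y : 0 ≤ C₁ * y := mul_nonneg hC₁ hy
  have hδ' : δ ≤ 2 * C₁ * y * dj := hδ.trans (by nlinarith)
  obtain ⟨hRlo, hRhi⟩ := abs_le.mp hRdj
  obtain ⟨hR0lo, hR0hi⟩ := abs_le.mp hRd0
  have e1 : 1 + C₁ * y ≤ Real.exp (C₁ * y) := by linarith [Real.add_one_le_exp (C₁ * y)]
  have e2 : 1 + 2 * C₁ * y ≤ Real.exp (2 * C₁ * y) := by linarith [Real.add_one_le_exp (2 * C₁ * y)]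
  have e4 : 1 + 4 * C₁ * y ≤ Real.exp (4 * C₁ * y) := by linarith [Real.add_one_le_exp (4 * C₁ * y)]
  constructor
  · have s1 : Rj * μ0 ≤ (1 + 2 * C₁ * y) * (dj * μ0) := by
      have : Rj ≤ (1 + 2 * C₁ * y) * dj := by nlinarith
      calc Rj * μ0 ≤ ((1 + 2 * C₁ * y) * dj) * μ0 := mul_le_mul_of_nonneg_right this hμ0
        _ = _ := by ring
    have s2 : (1 + 2 * C₁ * y) * (dj * μ0) ≤ Real.exp (2 * C₁ * y) * (dj * μ0) :=
      mul_le_mul_of_nonneg_right e2 (mul_nonneg hdj hμ0)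
    have s3 : Real.exp (2 * C₁ * y) * (dj * μ0) ≤ Real.exp (2 * C₁ * y) * (Real.exp (C * y) * (μj * d0)) :=
      mul_le_mul_of_nonneg_left h1 (Real.exp_pos _).le
    have s4 : μj * d0 ≤ μj * R0 := mul_le_mul_of_nonneg_left hd0R0 hμj
    have s5 : Real.exp (2 * C₁ * y) * Real.exp (C * y) ≤ Real.exp ((C + 5 * C₁) * y) := by
      rw [← Real.exp_add]
      exact Real.exp_le_exp.mpr (by nlinarith)
    calc Rj * μ0 ≤ (1 + 2 * C₁ * y) * (dj * μ0) := s1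
      _ ≤ Real.exp (2 * C₁ * y) * (dj * μ0) := s2
      _ ≤ Real.exp (2 * C₁ * y) * (Real.exp (C * y) * (μj * d0)) := s3
      _ = (Real.exp (2 * C₁ * y) * Real.exp (C * y)) * (μj * d0) := by ring
      _ ≤ Real.exp ((C + 5 * C₁) * y) * (μj * R0) :=
          mul_le_mul s5 s4 (mul_nonneg hμj hd0) (Real.exp_pos _).le
  · have t1 : μj * R0 ≤ (1 + C₁ * y) * (μj * d0) := by
      have : R0 ≤ (1 + C₁ * y) * d0 := by nlinarith
      calc μj * R0 ≤ μj * ((1 + C₁ * y) * d0) := mul_le_mul_of_nonneg_left this hμj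
        _ = _ := by ring
    have t2 : (1 + C₁ * y) * (μj * d0) ≤ Real.exp (C₁ * y) * (μj * d0) :=
      mul_le_mul_of_nonneg_right e1 (mul_nonneg hμj hd0)
    have t3 : Real.exp (C₁ * y) * (μj * d0) ≤ Real.exp (C₁ * y) * (Real.exp (C * y) * (dj * μ0)) :=
      mul_le_mul_of_nonneg_left h2 (Real.exp_pos _).le
    -- `dj ≤ (1 + 4C₁y) Rj` without division
    have hz : dj * (1 - 2 * C₁ * y) ≤ Rj := by nlinarith
    have h14 : 0 ≤ 1 + 4 * C₁ * y := by nlinarith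
    have t4 : dj ≤ (1 + 4 * C₁ * y) * Rj := by
      have hz0 : 0 ≤ 2 * C₁ * y := by nlinarith
      have hz1 : 0 ≤ 1 - 2 * (2 * C₁ * y) := by linarith
      have hprod : 1 ≤ (1 - 2 * C₁ * y) * (1 + 4 * C₁ * y) := by nlinarith [mul_nonneg hz0 hz1]
      calc dj = dj * 1 := (mul_one _).symm
        _ ≤ dj * ((1 - 2 * C₁ * y) * (1 + 4 * C₁ * y)) := mul_le_mul_of_nonneg_left hprod hdj
        _ = (dj * (1 - 2 * C₁ * y)) * (1 + 4 * C₁ * y) := by ring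
        _ ≤ Rj * (1 + 4 * C₁ * y) := mul_le_mul_of_nonneg_right hz h14
        _ = (1 + 4 * C₁ * y) * Rj := mul_comm _ _
    have t5 : dj * μ0 ≤ Real.exp (4 * C₁ * y) * (Rj * μ0) := by
      calc dj * μ0 ≤ ((1 + 4 * C₁ * y) * Rj) * μ0 := mul_le_mul_of_nonneg_right t4 hμ0
        _ ≤ (Real.exp (4 * C₁ * y) * Rj) * μ0 :=
            mul_le_mul_of_nonneg_right (mul_le_mul_of_nonneg_right e4 hRj) hμ0
        _ = _ := by ring
    have t6 : Real.exp (C₁ * y) * Real.exp (C * y) * Real.exp (4 * C₁ * y) = Real.exp ((C + 5 * C₁) * y) := by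
      rw [← Real.exp_add, ← Real.exp_add]
      congr 1
      ring
    calc μj * R0 ≤ (1 + C₁ * y) * (μj * d0) := t1
      _ ≤ Real.exp (C₁ * y) * (μj * d0) := t2
      _ ≤ Real.exp (C₁ * y) * (Real.exp (C * y) * (dj * μ0)) := t3
      _ = (Real.exp (C₁ * y) * Real.exp (C * y)) * (dj * μ0) := by ring
      _ ≤ (Real.exp (C₁ * y) * Real.exp (C * y)) * (Real.exp (4 * C₁ * y) * (Rj * μ0)) :=
          mul_le_mul_of_nonneg_left t5 (by positivity)
      _ = Real.exp ((C + 5 * C₁) * y) * (Rj * μ0) := by rw [← t6]; ring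

/-- **`DiagonalPlateau` — the GEVP-free generator cut (memo §4).**  For every `k` and `η > 0`, eventually in the window, `k+1` PHYSICAL UNIT generators
`v_0 … v_k` with: (p0) sorted diagonal forms `d_0 ≥ … ≥ d_k`, `d_i := qform(v_i,v_i)`; (p1) `|l2(v_i,v_l)| ≤ Cλ` (`i ≠ l`); (p2) one-step residuals
`‖K v_i − d_i v_i‖² ≤ C(λ³/L²)d₀²`; (p3) `d_j μ₀ ≤ e^{Cλ²/L} μ_j d₀` and `μ_j d₀ ≤ e^{Cλ²/L} d_j μ₀`; (p4) `|qform(v_i,v_l) − ½(d_i+d_l) l2(v_i,v_l)| ≤ C(λ²/L)d₀`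
(`i ≠ l`); (p5) `d₀ − d_k ≤ C(λ/L)d₀`; (p6) `qform(ψ,ψ) ≤ e^{ηλ/L} d₀ ‖ψ‖²` for physical `ψ`. -/
def DiagonalPlateau : Prop :=
  ∀ k : ℕ, ∀ η : ℝ, 0 < η → ∃ C lam0 : ℝ, 0 < lam0 ∧ ∀ lam : ℝ, 0 < lam → lam ≤ lam0 → ∃ L0 : ℕ,
    ∀ (L : ℕ) [NeZero L], L0 ≤ L → ∀ β : ℝ, InFemtoWindow lam β L →
      ∃ v : Fin (k + 1) → (GaugeConfig 3 L Theorems.FemtoTransferGap.SU2 → ℝ),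
        (∀ i, IsPhys (v i)) ∧ (∀ i, l2 (v i) (v i) = 1) ∧
        (∀ i l : Fin (k + 1), i ≤ l → qform su2Rep β (v l) (v l) ≤ qform su2Rep β (v i) (v i)) ∧
        (∀ i l : Fin (k + 1), i ≠ l → |l2 (v i) (v l)| ≤ C * luscherLambda β L) ∧
        (∀ i, l2 (transferApply β (v i) - qform su2Rep β (v i) (v i) • v i)
            (transferApply β (v i) - qform su2Rep β (v i) (v i) • v i)
            ≤ C * (luscherLambda β L ^ 3 / (L : ℝ) ^ 2) * qform su2Rep β (v 0) (v 0) ^ 2) ∧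
        (∀ j : Fin (k + 1),
          qform su2Rep β (v j) (v j) * levelValue su2Rep 1 (oneSiteCoupling β L) 0 ≤
              Real.exp (C * luscherLambda β L ^ 2 / L) *
                (levelValue su2Rep 1 (oneSiteCoupling β L) j * qform su2Rep β (v 0) (v 0)) ∧
          levelValue su2Rep 1 (oneSiteCoupling β L) j * qform su2Rep β (v 0) (v 0) ≤
              Real.exp (C * luscherLambda β L ^ 2 / L) *
                (qform su2Rep β (v j) (v j) * levelValue su2Rep 1 (oneSiteCoupling β L) 0)) ∧
        (∀ i l : Fin (k + 1), i ≠ l →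
          |qform su2Rep β (v i) (v l) - (qform su2Rep β (v i) (v i) + qform su2Rep β (v l) (v l)) / 2 * l2 (v i) (v l)|
            ≤ C * (luscherLambda β L ^ 2 / L) * qform su2Rep β (v 0) (v 0)) ∧
        (qform su2Rep β (v 0) (v 0) - qform su2Rep β (v (Fin.last k)) (v (Fin.last k))
            ≤ C * (luscherLambda β L / L) * qform su2Rep β (v 0) (v 0)) ∧
        (∀ ψ : GaugeConfig 3 L Theorems.FemtoTransferGap.SU2 → ℝ, IsPhys ψ →
          qform su2Rep β ψ ψ ≤ Real.exp (η * luscherLambda β L / L) * qform su2Rep β (v 0) (v 0) * l2 ψ ψ)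

set_option maxHeartbeats 1600000 in
/-- **`DiagonalPlateau → RitzGenerators`** (hence `→ DressedRitz = stub_dressedRitz`): LEMMA B (`ritz_near_diagonal`) in the physical subspace with
`ε = C'λ`, `τ = C'(λ²/L)d₀`, `σ = C'(λ/L)d₀` gives `|ritzValue_j − d_j| ≤ C₁(λ²/L)d₀`; `twoSided_of_additive` converts to (g3); (g1) is the Gram
lower bound, (g2)/(g4) use `d₀ ≤ ritzValue₀`.  Constants: `C' = max C 1`, `C₁ = 2(2nC' + 4n²C'³)`, output `C' + 5C₁`, `lam0' = min lam0 (1/(8nC'(C₁+1)))`. -/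
theorem ritzGenerators_of_diagonalPlateau (h : DiagonalPlateau) : RitzGenerators := by
  intro k η hη
  obtain ⟨C, lam0, hlam0, hC⟩ := h k η hη
  -- constants
  set n : ℝ := (k : ℝ) + 1 with hndef
  have hn1 : 1 ≤ n := by rw [hndef]; have := (Nat.cast_nonneg k : (0 : ℝ) ≤ k); linarith
  have hn0 : 0 ≤ n := zero_le_one.trans hn1
  have hncast : ((k + 1 : ℕ) : ℝ) = n := by rw [hndef]; push_cast; ring
  set C' : ℝ := max C 1 with hC'def
  have hC'1 : 1 ≤ C' := le_max_right C 1
  have hC'0 : 0 ≤ C' := zero_le_one.trans hC'1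
  have hCC' : C ≤ C' := le_max_left C 1
  set C₁ : ℝ := 2 * (2 * n * C' + 4 * n ^ 2 * C' ^ 3) with hC₁def
  have hC₁0 : 0 ≤ C₁ := by rw [hC₁def]; positivity
  set CR : ℝ := C' + 5 * C₁ with hCRdef
  have hC'CR : C' ≤ CR := by rw [hCRdef]; linarith
  have hCCR : C ≤ CR := hCC'.trans hC'CR
  set M : ℝ := 4 * n * C' * (C₁ + 1) with hMdef
  have hM4 : 4 ≤ M := by
    rw [hMdef]
    have h1 : 1 ≤ n * C' := by nlinarith
    have h2 : 1 ≤ C₁ + 1 := by linarith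
    nlinarith [mul_le_mul h1 h2 zero_le_one (by positivity)]
  have hM0 : 0 < M := by linarith
  set lam1 : ℝ := min lam0 (1 / (2 * M)) with hlam1def
  have hlam1 : 0 < lam1 := lt_min hlam0 (by positivity)
  refine ⟨CR, lam1, hlam1, fun lam hlam hle => ?_⟩
  obtain ⟨L0, hL0⟩ := hC lam hlam (hle.trans (min_le_left _ _))
  refine ⟨L0, fun L _ hL β hW => ?_⟩
  obtain ⟨v, hphys, hnorm, hsort, hoff, hres, hpos, hcoup, hspread, htop⟩ := hL0 L hL β hW
  have hβ1 : (1 : ℝ) ≤ β := hW.1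
  have hβ0 : (0 : ℝ) ≤ β := zero_le_one.trans hβ1
  -- the slow coordinate `x = λ` and its smallness
  set x : ℝ := luscherLambda β L with hxdef
  have hx0 : 0 ≤ x := luscherLambda_nonneg β L
  have hxlam : x ≤ 2 * lam := hW.2.2
  have hxM : x * M ≤ 1 := by
    have h1 : lam ≤ 1 / (2 * M) := hle.trans (min_le_right _ _)
    have h2 : x ≤ 1 / M := by
      calc x ≤ 2 * lam := hxlam
        _ ≤ 2 * (1 / (2 * M)) := by linarith
        _ = 1 / M := by field_simp
    have := (le_div_iff₀ hM0).mp h2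
    linarith
  have hx1 : x ≤ 1 := by nlinarith
  have hnCx : n * C' * x ≤ 1 / 4 := by
    have : 4 * (n * C' * x) * (C₁ + 1) = x * M := by rw [hMdef]; ring
    nlinarith [mul_nonneg (mul_nonneg hn0 hC'0) hx0]
  have hC'x : C' * x ≤ 1 / 4 := by nlinarith [mul_nonneg hC'0 hx0]
  have hC₁x : C₁ * x ≤ 1 / 4 := by
    have h1 : 4 * (C₁ * x) ≤ 4 * ((C₁ + 1) * x) := by nlinarith
    have h2 : 4 * ((C₁ + 1) * x) ≤ 4 * ((C₁ + 1) * x) * (n * C') := by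
      have : 1 ≤ n * C' := by nlinarith
      nlinarith [mul_nonneg (by linarith : (0:ℝ) ≤ C₁ + 1) hx0]
    have h3 : 4 * ((C₁ + 1) * x) * (n * C') = x * M := by rw [hMdef]; ring
    nlinarith
  have hL1 : (1 : ℝ) ≤ (L : ℝ) := by exact_mod_cast Nat.one_le_iff_ne_zero.mpr (NeZero.ne L)
  have hL0' : (0 : ℝ) < (L : ℝ) := by linarith
  set y : ℝ := x ^ 2 / (L : ℝ) with hydef
  have hy0 : 0 ≤ y := div_nonneg (sq_nonneg _) hL0'.le
  have hyx : y ≤ x := by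
    rw [hydef, div_le_iff₀ hL0']
    nlinarith
  have hx3 : 0 ≤ x ^ 3 / (L : ℝ) ^ 2 := div_nonneg (pow_nonneg hx0 3) (sq_nonneg _)
  -- packaged family, forms
  let V : Fin (k + 1) → physSubmodule L := fun i => ⟨v i, hphys i⟩
  have hVv : (fun i => (V i : GaugeConfig 3 L Theorems.FemtoTransferGap.SU2 → ℝ)) = v := rfl
  set ip := l2Form L with hip
  set K := transferOp (L := L) β with hK
  set E : physSubmodule L →ₗ[ℝ] physSubmodule L →ₗ[ℝ] ℝ := ip.compl₂ K with hE
  have hE_apply : ∀ a b, E a b = ip a (K b) := fun a b => LinearMap.compl₂_apply _ _ _ _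
  have hEq : ∀ a b : physSubmodule L, E a b = qform su2Rep β (a : GaugeConfig 3 L Theorems.FemtoTransferGap.SU2 → ℝ) b := fun a b => by
    rw [hE_apply, hip, hK, l2Form_transferOp_right]
  have hip_symm : ∀ a b, ip a b = ip b a := l2Form_symm
  have hip_nonneg : ∀ a, 0 ≤ ip a a := l2Form_self_nonneg
  have hKsymm : ∀ a b, ip (K a) b = ip a (K b) := transferOp_symm β
  have hE_symm : ∀ a b, E a b = E b a := fun a b => by
    rw [hE_apply, hE_apply, ← hKsymm, hip_symm]
  -- diagonal data
  set d : Fin (k + 1) → ℝ := fun i => qform su2Rep β (v i) (v i) with hddef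
  have hd_anti : Antitone d := fun i l hil => hsort i l hil
  have hdE : ∀ i, E (V i) (V i) = d i := fun i => by rw [hEq]
  have hd0 : ∀ i, 0 ≤ d i := fun i => qform_su2Rep_self_nonneg hβ0 (hphys i)
  have hunit : ∀ i, ip (V i) (V i) = 1 := fun i => by rw [hip, l2Form_apply]; exact hnorm i
  have hdle0 : ∀ i, d i ≤ d 0 := fun i => hd_anti (Fin.zero_le i)
  have hdgek : ∀ i, d (Fin.last k) ≤ d i := fun i => hd_anti (Fin.le_last i)
  -- tolerances
  set ε : ℝ := C' * x with hεdef
  have hε0 : 0 ≤ ε := mul_nonneg hC'0 hx0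
  have hnε : n * ε ≤ 1 / 4 := by rw [hεdef, ← mul_assoc]; exact hnCx
  set τ : ℝ := C' * y * d 0 with hτdef
  have hτ0 : 0 ≤ τ := mul_nonneg (mul_nonneg hC'0 hy0) (hd0 0)
  set σ : ℝ := C' * (x / (L : ℝ)) * d 0 with hσdef
  have hxL : 0 ≤ x / (L : ℝ) := div_nonneg hx0 hL0'.le
  have hxL' : x / (L : ℝ) ≤ x := by rw [div_le_iff₀ hL0']; nlinarith
  have hσ0 : 0 ≤ σ := mul_nonneg (mul_nonneg hC'0 hxL) (hd0 0)
  have hG' : ∀ i l, |ip (V i) (V l) - (if i = l then 1 else 0)| ≤ ε := by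
    intro i l
    by_cases hil : i = l
    · subst hil; simp [hunit, hε0]
    · rw [if_neg hil, sub_zero, hip, l2Form_apply]
      exact (hoff i l hil).trans (mul_le_mul_of_nonneg_right hCC' hx0)
  have hGoff : ∀ i l, i ≠ l → |ip (V i) (V l)| ≤ ε := fun i l hil => by simpa [hil] using hG' i l
  have hSoff : ∀ i l, i ≠ l → |E (V i) (V l) - (d i + d l) / 2 * ip (V i) (V l)| ≤ τ := by
    intro i l hil
    rw [hEq, hip, l2Form_apply]
    refine (hcoup i l hil).trans ?_
    rw [hτdef, hydef]
    exact mul_le_mul_of_nonneg_right (mul_le_mul_of_nonneg_right hCC' hy0) (hd0 0)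
  have hσ' : ∀ i l, |d i - d l| ≤ σ := by
    intro i l
    have hsp : d 0 - d (Fin.last k) ≤ σ := by
      refine hspread.trans ?_
      rw [hσdef]
      exact mul_le_mul_of_nonneg_right (mul_le_mul_of_nonneg_right hCC' hxL) (hd0 0)
    rw [abs_sub_le_iff]
    constructor <;> linarith [hdle0 i, hdle0 l, hdgek i, hdgek l]
  -- Gram conditioning from (p1)
  have hgramV : ∀ b : Fin (k + 1) → ℝ, (1 - n * ε) * ∑ l, b l ^ 2 ≤ ip (∑ l, b l • V l) (∑ l, b l • V l) := by
    intro b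
    have hg := gram_lower (fun i l => ip (V i) (V l)) b ε hε0 hG'
    rw [Fintype.card_fin, hncast] at hg
    rw [bilin_sum_smul_sum_smul]
    exact hg
  have hgram' : ∀ b : Fin (k + 1) → ℝ, (1 / 2 : ℝ) * ∑ l, b l ^ 2 ≤ ip (∑ l, b l • V l) (∑ l, b l • V l) := by
    intro b
    have h1 := hgramV b
    have h2 : 0 ≤ ∑ l, b l ^ 2 := Finset.sum_nonneg fun l _ => sq_nonneg _
    nlinarith
  have hG : (Matrix.of fun i l => ip (V i) (V l)).PosDef := by
    refine Matrix.posDef_iff_dotProduct_mulVec.mpr ⟨?_, fun c hc => ?_⟩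
    · ext i l
      simp only [Matrix.conjTranspose_apply, Matrix.of_apply, star_trivial, hip_symm (V l) (V i)]
    · have hquad : dotProduct (star c) (Matrix.mulVec (Matrix.of fun i l => ip (V i) (V l)) c) =
          ip (∑ i, c i • V i) (∑ l, c l • V l) := by
        rw [bilin_sum_smul_sum_smul, star_trivial, dotProduct]
        refine Finset.sum_congr rfl fun i _ => ?_
        rw [Matrix.mulVec, dotProduct, Finset.mul_sum]
        refine Finset.sum_congr rfl fun l _ => ?_
        simp only [Matrix.of_apply]
        ring
      rw [hquad]
      have hpos : 0 < ∑ i, c i ^ 2 := by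
        obtain ⟨i, hi⟩ : ∃ i, c i ≠ 0 := by
          by_contra h0
          push Not at h0
          exact hc (funext h0)
        exact lt_of_lt_of_le (by positivity : 0 < c i ^ 2)
          (Finset.single_le_sum (fun l _ => sq_nonneg (c l)) (Finset.mem_univ i))
      have := hgram' c
      linarith
  -- Ritz rotation and in-span Courant–Fischer
  obtain ⟨u, m, hanti, hu', hon', hdiag'⟩ := exists_orthonormal_formDiagonal_antitone ip E hE_symm V hG
  have hu : ∀ i, (u i : GaugeConfig 3 L Theorems.FemtoTransferGap.SU2 → ℝ) ∈ Submodule.span ℝ (Set.range v) := fun i => by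
    rw [← hVv, ← coe_mem_span_iff]; exact hu' i
  have hon : ∀ i l, l2 (u i : GaugeConfig 3 L Theorems.FemtoTransferGap.SU2 → ℝ) (u l) = if i = l then 1 else 0 := fun i l => by
    rw [← l2Form_apply]; exact hon' i l
  have hdiag : ∀ i l, qform su2Rep β (u i : GaugeConfig 3 L Theorems.FemtoTransferGap.SU2 → ℝ) (u l) = if i = l then m i else 0 := fun i l => by
    rw [← hEq]; exact hdiag' i l
  have hspan := span_coe_eq_span v u hu hon
  have hvu : ∀ l, V l ∈ Submodule.span ℝ (Set.range u) := fun l => by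
    rw [coe_mem_span_iff, hspan]
    exact Submodule.subset_span ⟨l, rfl⟩
  have hRj : ∀ j : Fin (k + 1), ritzValue β v j = m j := fun j => by
    have hj : (j : ℕ) ≤ k := Nat.le_of_lt_succ j.2
    have h := ritzValue_eq_ritzDiag hβ0 hphys hu hon hdiag hanti hj
    rw [Fin.eta] at h
    exact h
  -- LEMMA B
  have hnε1 : (↑(k + 1 : ℕ) : ℝ) * ε < 1 := by rw [hncast]; linarith
  have hB : ∀ j : Fin (k + 1), |m j - d j| ≤ C₁ * y * d 0 := by
    intro j
    have hb := ritz_near_diagonal ip E V d hdE hd_anti hunit hε0 hτ0 hnε1 hGoff hSoff hσ' u m hanti hu' hvu hon' hdiag' j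
    rw [hncast] at hb
    refine hb.trans ?_
    -- (nτ + 2n²σε²)/(1 − nε) ≤ C₁ y d₀
    have hθ : (1 : ℝ) / 2 ≤ 1 - n * ε := by linarith
    have hnum0 : 0 ≤ n * τ + 2 * n ^ 2 * σ * ε ^ 2 := by positivity
    rw [div_le_iff₀ (by linarith : (0 : ℝ) < 1 - n * ε)]
    -- numerator ≤ (nC' + 2n²C'³) y d₀  (uses x ≤ 1 and x/L·x² = y·x ≤ y)
    have hσε : σ * ε ^ 2 ≤ C' ^ 3 * y * d 0 := by
      rw [hσdef, hεdef, hydef]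
      have hkey : x / (L : ℝ) * x ^ 2 = x ^ 2 / (L : ℝ) * x := by ring
      have : C' * (x / ↑L) * d 0 * (C' * x) ^ 2 = C' ^ 3 * (x ^ 2 / ↑L * x) * d 0 := by rw [← hkey]; ring
      rw [this]
      have hyx1 : x ^ 2 / ↑L * x ≤ x ^ 2 / ↑L := by
        have := mul_le_mul_of_nonneg_left hx1 hy0
        rw [hydef] at this; simpa using this
      exact mul_le_mul_of_nonneg_right (mul_le_mul_of_nonneg_left hyx1 (by positivity)) (hd0 0)
    have hnum : n * τ + 2 * n ^ 2 * σ * ε ^ 2 ≤ (n * C' + 2 * n ^ 2 * C' ^ 3) * y * d 0 := by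
      rw [hτdef]
      nlinarith [mul_le_mul_of_nonneg_left hσε (by positivity : (0 : ℝ) ≤ 2 * n ^ 2)]
    have hfin : (n * C' + 2 * n ^ 2 * C' ^ 3) * y * d 0 ≤ C₁ * y * d 0 * (1 - n * ε) := by
      rw [hC₁def]
      have hyd : 0 ≤ y * d 0 := mul_nonneg hy0 (hd0 0)
      nlinarith [mul_le_mul_of_nonneg_left hθ (by positivity : (0 : ℝ) ≤ (2 * n * C' + 4 * n ^ 2 * C' ^ 3) * (y * d 0))]
    linarith
  -- `d₀ ≤ m₀ = ritzValue₀` (no constraints)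
  have hd0m0 : d 0 ≤ m 0 := by
    have h := rayleigh_le_of_mem_span_of_orthogonal ip E u m hon' hdiag' (j := 0) (mhi := m 0)
      (fun i _ => hanti (Fin.zero_le i)) (hvu 0) (fun i hi => absurd hi (Nat.not_lt_zero _))
    rw [hdE, hunit, mul_one] at h
    exact h
  have hm0 : ∀ i, 0 ≤ m i := fun i => by
    have : qform su2Rep β (u i : GaugeConfig 3 L Theorems.FemtoTransferGap.SU2 → ℝ) (u i) = m i := by rw [hdiag, if_pos rfl]
    rw [← this]; exact qform_su2Rep_self_nonneg hβ0 (isPhys_coe _)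
  have hμ : ∀ j : ℕ, 0 ≤ levelValue su2Rep 1 (oneSiteCoupling β L) j := fun j =>
    levelValue_su2Rep_nonneg 1 (oneSiteCoupling_nonneg β L) j
  -- small-parameter facts for the conversion
  have hsmall : 2 * C₁ * y ≤ 1 / 2 := by nlinarith
  have hd0dj : ∀ j : Fin (k + 1), d 0 ≤ 2 * d j := by
    intro j
    have h1 : d 0 - d j ≤ σ := (le_abs_self _).trans (hσ' 0 j)
    have h2 : σ ≤ d 0 / 2 := by
      rw [hσdef]
      have : C' * (x / ↑L) ≤ 1 / 4 := (mul_le_mul_of_nonneg_left hxL' hC'0).trans hC'x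
      nlinarith [hd0 0]
    linarith
  -- the two-sided Ritz positions
  have hmain : ∀ j : Fin (k + 1),
      m j * levelValue su2Rep 1 (oneSiteCoupling β L) 0 ≤
          Real.exp (CR * x ^ 2 / L) * (levelValue su2Rep 1 (oneSiteCoupling β L) j * m 0) ∧
        levelValue su2Rep 1 (oneSiteCoupling β L) j * m 0 ≤
          Real.exp (CR * x ^ 2 / L) * (m j * levelValue su2Rep 1 (oneSiteCoupling β L) 0) := by
    intro j
    obtain ⟨h1, h2⟩ := hpos j
    rw [mul_div_assoc] at h1 h2
    have hres2 := twoSided_of_additive (C := C) hy0 hC₁0 hsmall (hμ j) (hμ 0) (hd0 j) (hd0 0)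
      ((hm0 j)) (hB j) (hB 0) le_rfl hd0m0 (hd0dj j) h1 h2
    obtain ⟨r1, r2⟩ := hres2
    have hs0 : 0 ≤ x ^ 2 / (L : ℝ) := hy0
    have hle' : C + 5 * C₁ ≤ CR := by rw [hCRdef]; linarith
    rw [← mul_div_assoc] at r1 r2
    exact ⟨le_exp_mul_div_of_le r1 hs0 (mul_nonneg (hμ j) (hm0 0)) hle',
      le_exp_mul_div_of_le r2 hs0 (mul_nonneg (hm0 j) (hμ 0)) hle'⟩
  have hR0 : ritzValue β v 0 = m 0 := hRj 0
  -- the witnesses: the generators themselves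
  refine ⟨v, hphys, hnorm, ?_, ?_, ?_, ?_⟩
  · -- (g1)
    intro c
    have h1 := hgram' c
    rw [hip, l2Form_apply, coe_sum_smul] at h1
    linarith
  · -- (g2)
    intro i
    refine (hres i).trans ?_
    rw [hR0]
    have hd0sq : d 0 ^ 2 ≤ m 0 ^ 2 := pow_le_pow_left₀ (hd0 0) hd0m0 2
    calc C * (x ^ 3 / ↑L ^ 2) * d 0 ^ 2 ≤ C' * (x ^ 3 / ↑L ^ 2) * d 0 ^ 2 :=
          mul_le_mul_of_nonneg_right (mul_le_mul_of_nonneg_right hCC' hx3) (sq_nonneg _)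
      _ ≤ CR * (x ^ 3 / ↑L ^ 2) * m 0 ^ 2 :=
          mul_le_mul (mul_le_mul_of_nonneg_right hC'CR hx3) hd0sq (sq_nonneg _) (mul_nonneg (hC'0.trans hC'CR) hx3)
  · -- (g3)
    intro j hj
    have h := hmain ⟨j, Nat.lt_succ_of_le hj⟩
    rw [← hRj, ← hR0] at h
    exact h
  · -- (g4)
    intro ψ hψ
    refine (htop ψ hψ).trans ?_
    rw [hR0]
    have hl2 : 0 ≤ l2 ψ ψ := l2_self_nonneg ψ
    exact mul_le_mul_of_nonneg_right (mul_le_mul_of_nonneg_left hd0m0 (Real.exp_pos _).le) hl2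

/-- `DiagonalPlateau → DressedRitz` (`= stub_dressedRitz` of «KTR»). -/
theorem dressedRitz_of_diagonalPlateau (h : DiagonalPlateau) : DressedRitz :=
  dressedRitz_of_ritzGenerators (ritzGenerators_of_diagonalPlateau h)



/-! ## §8 (rev 3) Threshold bookkeeping and the pure-real spread lemma (for the certificate of §10) -/

/-- In the femto window, a small level `lam ≤ 1/(4·max B₀ 1)` puts the effective one-site coupling beyond any threshold `B₀`:
`B(β,L) ≥ 1/(4 lam³) ≥ 1/(4 lam) ≥ max B₀ 1`. (The computation inside `KTRCalibration.levelValue_pos_of_red_one`, exported.) [folklore] -/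
theorem oneSiteCoupling_ge_of_small_level {B0 lam β : ℝ} {L : ℕ} [NeZero L] (hlam : 0 < lam) (hlam1 : lam ≤ 1)
    (hlamB : lam ≤ 1 / (4 * max B0 1)) (hW : InFemtoWindow lam β L) : B0 ≤ oneSiteCoupling β L := by
  have hB1 : 1 / (4 * lam ^ 3) ≤ oneSiteCoupling β L := oneSiteCoupling_ge_of_window hlam hW
  have hM1 : (1 : ℝ) ≤ max B0 1 := le_max_right _ _
  have hM0 : 0 < max B0 1 := zero_lt_one.trans_le hM1
  have hlam3 : lam ^ 3 ≤ lam := by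
    have h1 : lam ^ 3 = lam * (lam * lam) := by ring
    rw [h1]
    have h2 : lam * lam ≤ 1 := by nlinarith
    nlinarith
  have h1 : max B0 1 ≤ 1 / (4 * lam) := by
    rw [le_div_iff₀ (by positivity)]
    have := (le_div_iff₀ (by positivity : (0 : ℝ) < 4 * max B0 1)).mp hlamB
    linarith
  have h2 : 1 / (4 * lam) ≤ 1 / (4 * lam ^ 3) :=
    one_div_le_one_div_of_le (by positivity) (by linarith)
  exact (le_max_left B0 1).trans (h1.trans (h2.trans hB1))

/-- **Relative spread from RED's and ONE's lower laws (pure real).**  If `μ₀ > 0`, `λ₀ ≥ 0`, `0 ≤ s ≤ 1 ≤ r`,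
`e^{−(D(s/r) + C₁(s/r)²)}μ₀ ≤ μ_k` (ONE from below at `λ_b = s/r`) and `μ_kλ₀ ≤ e^{Cs²/r}λ_kμ₀` (RED from below), then
`λ₀ − λ_k ≤ (|C| + |D| + |C₁|)(s/r)λ₀` — via `λ_k ≥ e^{−x}λ₀`, `x = Cs·(s/r) + D(s/r) + C₁(s/r)²`, and `1 − e^{−x} ≤ x ≤ (|C|+|D|+|C₁|)(s/r)`. [folklore] -/
theorem spread_le_of_red_one {l0 lk m0 mk C D C1 s r : ℝ}
    (hm0 : 0 < m0) (hl0 : 0 ≤ l0) (hs0 : 0 ≤ s) (hs1 : s ≤ 1) (hr : 1 ≤ r)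
    (hONE : Real.exp (-(D * (s / r) + C1 * (s / r) ^ 2)) * m0 ≤ mk)
    (hRED : mk * l0 ≤ Real.exp (C * s ^ 2 / r) * (lk * m0)) :
    l0 - lk ≤ (|C| + |D| + |C1|) * (s / r) * l0 := by
  have hr0 : 0 < r := one_pos.trans_le hr
  have ht0 : 0 ≤ s / r := div_nonneg hs0 hr0.le
  have ht1 : s / r ≤ 1 := by
    rw [div_le_one hr0]
    exact hs1.trans hr
  have hCs : C * s ^ 2 / r = C * s * (s / r) := by ring
  rw [hCs] at hRED
  -- step 1: chain the two lower laws and cancel `μ₀ > 0`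
  have h1 : Real.exp (-(D * (s / r) + C1 * (s / r) ^ 2)) * m0 * l0 ≤ Real.exp (C * s * (s / r)) * (lk * m0) :=
    (mul_le_mul_of_nonneg_right hONE hl0).trans hRED
  have h2 : Real.exp (-(D * (s / r) + C1 * (s / r) ^ 2)) * l0 ≤ Real.exp (C * s * (s / r)) * lk := by
    have h1' : m0 * (Real.exp (-(D * (s / r) + C1 * (s / r) ^ 2)) * l0) ≤ m0 * (Real.exp (C * s * (s / r)) * lk) := by
      calc m0 * (Real.exp (-(D * (s / r) + C1 * (s / r) ^ 2)) * l0)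
          = Real.exp (-(D * (s / r) + C1 * (s / r) ^ 2)) * m0 * l0 := by ring
        _ ≤ Real.exp (C * s * (s / r)) * (lk * m0) := h1
        _ = m0 * (Real.exp (C * s * (s / r)) * lk) := by ring
    exact le_of_mul_le_mul_left h1' hm0
  -- step 2: `λ_k ≥ e^{−x} λ₀`
  have h3 : Real.exp (-(C * s * (s / r) + (D * (s / r) + C1 * (s / r) ^ 2))) * l0 ≤ lk := by
    have hpos : 0 ≤ Real.exp (-(C * s * (s / r))) := (Real.exp_pos _).le
    have h := mul_le_mul_of_nonneg_left h2 hpos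
    have e1 : Real.exp (-(C * s * (s / r))) * (Real.exp (-(D * (s / r) + C1 * (s / r) ^ 2)) * l0)
        = Real.exp (-(C * s * (s / r) + (D * (s / r) + C1 * (s / r) ^ 2))) * l0 := by
      rw [← mul_assoc, ← Real.exp_add]
      congr 1
      congr 1
      ring
    have e2 : Real.exp (-(C * s * (s / r))) * (Real.exp (C * s * (s / r)) * lk) = lk := by
      rw [← mul_assoc, ← Real.exp_add, neg_add_cancel, Real.exp_zero, one_mul]
    rw [e1, e2] at h
    exact h
  -- step 3: `1 − e^{−x} ≤ x`
  have h4 : l0 - lk ≤ l0 * (C * s * (s / r) + (D * (s / r) + C1 * (s / r) ^ 2)) := by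
    have hex : 1 - (C * s * (s / r) + (D * (s / r) + C1 * (s / r) ^ 2))
        ≤ Real.exp (-(C * s * (s / r) + (D * (s / r) + C1 * (s / r) ^ 2))) := by
      linarith [Real.add_one_le_exp (-(C * s * (s / r) + (D * (s / r) + C1 * (s / r) ^ 2)))]
    have h5 := mul_le_mul_of_nonneg_left hex hl0
    nlinarith [h5, h3]
  -- step 4: `x ≤ (|C| + |D| + |C₁|)(s/r)`
  have h6 : C * s * (s / r) + (D * (s / r) + C1 * (s / r) ^ 2) ≤ (|C| + |D| + |C1|) * (s / r) := by
    have a1 : C * s * (s / r) ≤ |C| * (s / r) := by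
      have : C * s ≤ |C| := by
        calc C * s ≤ |C| * s := mul_le_mul_of_nonneg_right (le_abs_self C) hs0
          _ ≤ |C| * 1 := mul_le_mul_of_nonneg_left hs1 (abs_nonneg C)
          _ = |C| := mul_one _
      exact mul_le_mul_of_nonneg_right this ht0
    have a2 : D * (s / r) ≤ |D| * (s / r) := mul_le_mul_of_nonneg_right (le_abs_self D) ht0
    have a3 : C1 * (s / r) ^ 2 ≤ |C1| * (s / r) := by
      have hsq : (s / r) ^ 2 ≤ s / r := by nlinarith
      calc C1 * (s / r) ^ 2 ≤ |C1| * (s / r) ^ 2 := mul_le_mul_of_nonneg_right (le_abs_self C1) (sq_nonneg _)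
        _ ≤ |C1| * (s / r) := mul_le_mul_of_nonneg_left hsq (abs_nonneg C1)
    linarith
  calc l0 - lk ≤ l0 * (C * s * (s / r) + (D * (s / r) + C1 * (s / r) ^ 2)) := h4
    _ ≤ l0 * ((|C| + |D| + |C1|) * (s / r)) := mul_le_mul_of_nonneg_left h6 hl0
    _ = (|C| + |D| + |C1|) * (s / r) * l0 := by ring

/-! ## §9 (rev 3) The vacuum generator is EXACT: the excited-sector cut `ExcitedPlateau` and `ExcitedPlateau → DiagonalPlateau` -/

/-- Real bookkeeping for the vacuum–excited coupling: `|λ₀X − ((λ₀+d)/2)X| = ((λ₀−d)/2)|X| ≤ C'²(s²/r)λ₀` from `|X| ≤ C's`,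
`0 ≤ λ₀ − d ≤ C'(s/r)λ₀`. [folklore] -/
theorem vacuumCoupling_aux {l0 d X C' s r : ℝ} (hC' : 0 ≤ C') (hs : 0 ≤ s) (hsr : 0 ≤ s / r) (hl0 : 0 ≤ l0)
    (hX : |X| ≤ C' * s) (hd0 : d ≤ l0) (hd : l0 - d ≤ C' * (s / r) * l0) :
    |l0 * X - (l0 + d) / 2 * X| ≤ C' ^ 2 * (s ^ 2 / r) * l0 := by
  have h1 : l0 * X - (l0 + d) / 2 * X = (l0 - d) / 2 * X := by ring
  rw [h1, abs_mul, abs_of_nonneg (by linarith : 0 ≤ (l0 - d) / 2)]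
  have hA : 0 ≤ C' * (s / r) * l0 := mul_nonneg (mul_nonneg hC' hsr) hl0
  have h2 : (l0 - d) / 2 * |X| ≤ C' * (s / r) * l0 / 2 * (C' * s) :=
    mul_le_mul (by linarith) hX (abs_nonneg X) (by linarith)
  have h3 : 0 ≤ C' ^ 2 * (s ^ 2 / r) * l0 := by
    have : C' ^ 2 * (s ^ 2 / r) * l0 = (C' * (s / r) * l0) * (C' * s) := by ring
    rw [this]
    exact mul_nonneg hA (mul_nonneg hC' hs)
  calc (l0 - d) / 2 * |X| ≤ C' * (s / r) * l0 / 2 * (C' * s) := h2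
    _ = C' ^ 2 * (s ^ 2 / r) * l0 / 2 := by ring
    _ ≤ C' ^ 2 * (s ^ 2 / r) * l0 := by linarith

/-- ★ **GEVP-free cut, EXCITED SECTOR ONLY (`ExcitedPlateau`).**  In `DiagonalPlateau` the vacuum generator `v₀` may be taken to be an EXACT
physical unit ground state `Ω` of `K_β` (`K_βΩ = λ₀Ω`; in the tree by `PhysL2.exists_isPhys_eigenfamily` at level `0`, `λ₀ > 0` by
`levelValue_zero_su2Rep_pos`) — and then (p6) top capture, the `j = 0` instances of (p2)/(p3)/(p5) and the `(0,l)` instances of (p0)/(p4) are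
AUTOMATIC (`qform(Ω,w) = λ₀⟨Ω,w⟩`, so the symmetrised vacuum coupling is `((λ₀−d_l)/2)·⟨Ω,w_l⟩ = O(λ/L)·O(λ)·λ₀`).  What remains is data on
`k` EXCITED generators `w₀ … w_{k−1}` (`w_i` sits at level `i+1`; no slab smoothing of the vacuum, no margin `η`): physical unit vectors with
(x1) sorted diagonal values `d_i = ⟨w_i,K_βw_i⟩`; (x2) near-orthogonality `|⟨w_i,w_l⟩| ≤ Cλ`; (x3) VACUUM OVERLAP: SOME physical unit
top eigenvector `φ` (`K_βφ = λ₀φ`; one exists by `exists_isPhys_eigenfamily hβ 0 (levelValue_zero_su2Rep_pos L β)`, the prover picks it — e.g. the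
positive Perron–Frobenius vector) has `|⟨φ,w_i⟩| ≤ Cλ` for all `i` (a one-point function in the vacuum; exactly `0` for a generator in a
non-trivial symmetry sector when `φ` is symmetric, memo §3) — this `φ` is the `Ω` used as `v₀`;
(x4) one-step residuals `‖K_βw_i − d_iw_i‖² ≤ C(λ³/L²)λ₀²` (effective-mass plateau); (x5) `d_i` in Lüscher position against the EXACT `λ₀`:
`d_i/λ₀ = (μ_{i+1}/μ₀)·e^{±Cλ²/L}`; (x6) symmetrised excited couplings `≤ C(λ²/L)λ₀`; (x7) spread `λ₀ − d_i ≤ C(λ/L)λ₀`.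
`diagonalPlateau_of_excitedPlateau : ExcitedPlateau → DiagonalPlateau` (hence `→ RitzGenerators → DressedRitz = stub_dressedRitz`). [folklore] -/
def ExcitedPlateau : Prop :=
  ∀ k : ℕ, ∃ C lam0 : ℝ, 0 < lam0 ∧ ∀ lam : ℝ, 0 < lam → lam ≤ lam0 → ∃ L0 : ℕ,
    ∀ (L : ℕ) [NeZero L], L0 ≤ L → ∀ β : ℝ, InFemtoWindow lam β L →
      ∃ w : Fin k → (GaugeConfig 3 L Theorems.FemtoTransferGap.SU2 → ℝ),
        (∀ i, IsPhys (w i)) ∧ (∀ i, l2 (w i) (w i) = 1) ∧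
        (∀ i l : Fin k, i ≤ l → qform su2Rep β (w l) (w l) ≤ qform su2Rep β (w i) (w i)) ∧
        (∀ i l : Fin k, i ≠ l → |l2 (w i) (w l)| ≤ C * luscherLambda β L) ∧
        (∃ φ : GaugeConfig 3 L Theorems.FemtoTransferGap.SU2 → ℝ, IsPhys φ ∧ l2 φ φ = 1 ∧
            transferApply β φ = levelValue su2Rep L β 0 • φ ∧ ∀ i, |l2 φ (w i)| ≤ C * luscherLambda β L) ∧
        (∀ i, l2 (transferApply β (w i) - qform su2Rep β (w i) (w i) • w i)
            (transferApply β (w i) - qform su2Rep β (w i) (w i) • w i)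
            ≤ C * (luscherLambda β L ^ 3 / (L : ℝ) ^ 2) * levelValue su2Rep L β 0 ^ 2) ∧
        (∀ i : Fin k,
          qform su2Rep β (w i) (w i) * levelValue su2Rep 1 (oneSiteCoupling β L) 0 ≤
              Real.exp (C * luscherLambda β L ^ 2 / L) *
                (levelValue su2Rep 1 (oneSiteCoupling β L) ((i : ℕ) + 1) * levelValue su2Rep L β 0) ∧
          levelValue su2Rep 1 (oneSiteCoupling β L) ((i : ℕ) + 1) * levelValue su2Rep L β 0 ≤
              Real.exp (C * luscherLambda β L ^ 2 / L) *
                (qform su2Rep β (w i) (w i) * levelValue su2Rep 1 (oneSiteCoupling β L) 0)) ∧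
        (∀ i l : Fin k, i ≠ l →
          |qform su2Rep β (w i) (w l) - (qform su2Rep β (w i) (w i) + qform su2Rep β (w l) (w l)) / 2 * l2 (w i) (w l)|
            ≤ C * (luscherLambda β L ^ 2 / L) * levelValue su2Rep L β 0) ∧
        (∀ i : Fin k, levelValue su2Rep L β 0 - qform su2Rep β (w i) (w i)
            ≤ C * (luscherLambda β L / L) * levelValue su2Rep L β 0)

set_option maxHeartbeats 800000 in
/-- ★★ **`ExcitedPlateau → DiagonalPlateau`: the vacuum generator of the GEVP-free cut may be taken EXACT.**  Witness family
`v := Fin.cons Ω w` with `Ω` the physical unit top eigenvector of (x3); output constant `(max C 1)²`, same `lam0`.  (p6) is the top Rayleigh bound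
`qform ≤ λ₀‖·‖²` (`qform_le_levelValue_zero_mul`), the vacuum residual is `0`, the vacuum Lüscher position is `λ₀μ₀ ≤ e^{(·)≥0}μ₀λ₀`, the
vacuum couplings are `vacuumCoupling_aux` from (x3) ∧ (x7), and (p0) at `(0,l)` is `d_l ≤ λ₀`. [cite: ReedSimonIV1978, Thm. XIII.1] -/
theorem diagonalPlateau_of_excitedPlateau (h : ExcitedPlateau) : DiagonalPlateau := by
  intro k η hη
  obtain ⟨C, lam0, hlam0, hC⟩ := h k
  set C' : ℝ := max C 1 with hC'def
  have hC'1 : 1 ≤ C' := le_max_right C 1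
  have hC'0 : 0 ≤ C' := zero_le_one.trans hC'1
  have hCC' : C ≤ C' := le_max_left C 1
  have hC'R : C' ≤ C' ^ 2 := by nlinarith
  have hCR : C ≤ C' ^ 2 := hCC'.trans hC'R
  have hR0 : 0 ≤ C' ^ 2 := sq_nonneg _
  refine ⟨C' ^ 2, lam0, hlam0, fun lam hlam hle => ?_⟩
  obtain ⟨L0, hL⟩ := hC lam hlam hle
  refine ⟨L0, fun L _ hL0 β hW => ?_⟩
  obtain ⟨w, hw, hunit, hanti, horth, ⟨Ω, hΩ, hΩ1, hKΩ, hvac⟩, hres, hlus, hcoup, hspr⟩ := hL L hL0 β hW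
  have hβ : (0 : ℝ) ≤ β := zero_le_one.trans hW.1
  have hB : 0 ≤ oneSiteCoupling β L := oneSiteCoupling_nonneg β L
  have hlam_nn : 0 ≤ luscherLambda β L := luscherLambda_nonneg β L
  have hLnn : (0 : ℝ) ≤ (L : ℝ) := Nat.cast_nonneg L
  have ht1 : 0 ≤ luscherLambda β L / L := div_nonneg hlam_nn hLnn
  have ht2 : 0 ≤ luscherLambda β L ^ 2 / L := div_nonneg (sq_nonneg _) hLnn
  have ht3 : 0 ≤ luscherLambda β L ^ 3 / (L : ℝ) ^ 2 := div_nonneg (pow_nonneg hlam_nn 3) (sq_nonneg _)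
  have hlv0 : 0 ≤ levelValue su2Rep L β 0 := (levelValue_zero_su2Rep_pos L β).le
  -- the exact vacuum generator `Ω` delivered by (x3): `‖Ω‖ = 1`, `K_βΩ = λ₀Ω`, hence `qform(Ω,Ω) = λ₀`
  have hqΩ : qform su2Rep β Ω Ω = levelValue su2Rep L β 0 := by
    rw [qform_eq_l2_transferApply, hKΩ, l2_comm Ω, l2_smul_left, hΩ1, mul_one]
  -- consequences of the excited data
  have hd_le : ∀ i, qform su2Rep β (w i) (w i) ≤ levelValue su2Rep L β 0 := fun i => by
    have h1 := qform_le_levelValue_zero_mul su2Rep continuous_su2Rep β (hw i) (by rw [hunit i]; exact one_pos)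
    rw [hunit i, mul_one] at h1
    exact h1
  have hvacΩ : ∀ i, |l2 Ω (w i)| ≤ C' * luscherLambda β L := fun i =>
    (hvac i).trans (mul_le_mul_of_nonneg_right hCC' hlam_nn)
  have hsprC : ∀ i, levelValue su2Rep L β 0 - qform su2Rep β (w i) (w i)
      ≤ C' * (luscherLambda β L / L) * levelValue su2Rep L β 0 := fun i =>
    (hspr i).trans (mul_le_mul_of_nonneg_right (mul_le_mul_of_nonneg_right hCC' ht1) hlv0)
  have hqΩw : ∀ i, qform su2Rep β Ω (w i) = levelValue su2Rep L β 0 * l2 Ω (w i) := fun i => by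
    rw [qform_su2Rep_comm β hΩ (hw i), qform_eq_l2_transferApply, hKΩ, l2_comm (w i), l2_smul_left]
  have hqwΩ : ∀ i, qform su2Rep β (w i) Ω = levelValue su2Rep L β 0 * l2 Ω (w i) := fun i => by
    rw [← qform_su2Rep_comm β hΩ (hw i)]
    exact hqΩw i
  have hbig1 : C' * luscherLambda β L ≤ C' ^ 2 * luscherLambda β L := mul_le_mul_of_nonneg_right hC'R hlam_nn
  refine ⟨(Fin.cons Ω w : Fin (k + 1) → GaugeConfig 3 L Theorems.FemtoTransferGap.SU2 → ℝ), fun i => ?_, fun i => ?_, fun i l hil => ?_,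
    fun i l hil => ?_, fun i => ?_, fun j => ?_, fun i l hil => ?_, ?_, fun ψ hψ => ?_⟩
  · -- physical
    rcases Fin.eq_zero_or_eq_succ i with rfl | ⟨i, rfl⟩
    · simp only [Fin.cons_zero]; exact hΩ
    · simp only [Fin.cons_succ]; exact hw i
  · -- unit norm
    rcases Fin.eq_zero_or_eq_succ i with rfl | ⟨i, rfl⟩
    · simp only [Fin.cons_zero]; exact hΩ1
    · simp only [Fin.cons_succ]; exact hunit i
  · -- (p0) sorted diagonal values
    rcases Fin.eq_zero_or_eq_succ i with rfl | ⟨i, rfl⟩ <;> rcases Fin.eq_zero_or_eq_succ l with rfl | ⟨l, rfl⟩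
    · exact le_rfl
    · simp only [Fin.cons_zero, Fin.cons_succ]; rw [hqΩ]; exact hd_le l
    · exact absurd hil (not_le.mpr (Fin.succ_pos i))
    · simp only [Fin.cons_succ]; exact hanti i l (Fin.succ_le_succ_iff.mp hil)
  · -- (p1) near-orthogonality
    rcases Fin.eq_zero_or_eq_succ i with rfl | ⟨i, rfl⟩ <;> rcases Fin.eq_zero_or_eq_succ l with rfl | ⟨l, rfl⟩
    · exact absurd rfl hil
    · simp only [Fin.cons_zero, Fin.cons_succ]; exact (hvacΩ l).trans hbig1
    · simp only [Fin.cons_zero, Fin.cons_succ]; rw [l2_comm (w i)]; exact (hvacΩ i).trans hbig1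
    · simp only [Fin.cons_succ]
      exact (horth i l (fun h => hil (by rw [h]))).trans (mul_le_mul_of_nonneg_right hCR hlam_nn)
  · -- (p2) one-step residuals
    rcases Fin.eq_zero_or_eq_succ i with rfl | ⟨i, rfl⟩
    · simp only [Fin.cons_zero]
      have hz : transferApply β Ω - qform su2Rep β Ω Ω • Ω = 0 := by rw [hKΩ, hqΩ, sub_self]
      rw [hz, l2_zero_zero]
      exact mul_nonneg (mul_nonneg hR0 ht3) (sq_nonneg _)
    · simp only [Fin.cons_zero, Fin.cons_succ]
      rw [hqΩ]
      exact (hres i).trans (mul_le_mul_of_nonneg_right (mul_le_mul_of_nonneg_right hCR ht3) (sq_nonneg _))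
  · -- (p3) Lüscher position
    rcases Fin.eq_zero_or_eq_succ j with rfl | ⟨j, rfl⟩
    · simp only [Fin.cons_zero, Fin.val_zero]
      rw [hqΩ]
      have hexp : 1 ≤ Real.exp (C' ^ 2 * luscherLambda β L ^ 2 / L) :=
        Real.one_le_exp (div_nonneg (mul_nonneg hR0 (sq_nonneg _)) hLnn)
      have hY : 0 ≤ levelValue su2Rep 1 (oneSiteCoupling β L) 0 * levelValue su2Rep L β 0 :=
        mul_nonneg (levelValue_su2Rep_nonneg 1 hB 0) hlv0
      constructor
      · calc levelValue su2Rep L β 0 * levelValue su2Rep 1 (oneSiteCoupling β L) 0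
            = 1 * (levelValue su2Rep 1 (oneSiteCoupling β L) 0 * levelValue su2Rep L β 0) := by ring
          _ ≤ Real.exp (C' ^ 2 * luscherLambda β L ^ 2 / L) *
              (levelValue su2Rep 1 (oneSiteCoupling β L) 0 * levelValue su2Rep L β 0) := mul_le_mul_of_nonneg_right hexp hY
      · calc levelValue su2Rep 1 (oneSiteCoupling β L) 0 * levelValue su2Rep L β 0
            = 1 * (levelValue su2Rep L β 0 * levelValue su2Rep 1 (oneSiteCoupling β L) 0) := by ring
          _ ≤ Real.exp (C' ^ 2 * luscherLambda β L ^ 2 / L) *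
              (levelValue su2Rep L β 0 * levelValue su2Rep 1 (oneSiteCoupling β L) 0) :=
            mul_le_mul_of_nonneg_right hexp (by rw [mul_comm]; exact hY)
    · simp only [Fin.cons_zero, Fin.cons_succ, Fin.val_succ]
      rw [hqΩ]
      obtain ⟨ha, hb⟩ := hlus j
      exact ⟨le_exp_mul_div_of_le ha ht2 (mul_nonneg (levelValue_su2Rep_nonneg 1 hB _) hlv0) hCR,
        le_exp_mul_div_of_le hb ht2 (mul_nonneg (qform_su2Rep_self_nonneg hβ (hw j)) (levelValue_su2Rep_nonneg 1 hB 0)) hCR⟩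
  · -- (p4) symmetrised couplings
    rcases Fin.eq_zero_or_eq_succ i with rfl | ⟨i, rfl⟩ <;> rcases Fin.eq_zero_or_eq_succ l with rfl | ⟨l, rfl⟩
    · exact absurd rfl hil
    · simp only [Fin.cons_zero, Fin.cons_succ]
      rw [hqΩ, hqΩw l]
      exact vacuumCoupling_aux hC'0 hlam_nn ht1 hlv0 (hvacΩ l) (hd_le l) (hsprC l)
    · simp only [Fin.cons_zero, Fin.cons_succ]
      rw [hqΩ, hqwΩ i, l2_comm (w i), add_comm (qform su2Rep β (w i) (w i))]
      exact vacuumCoupling_aux hC'0 hlam_nn ht1 hlv0 (hvacΩ i) (hd_le i) (hsprC i)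
    · simp only [Fin.cons_zero, Fin.cons_succ]
      rw [hqΩ]
      exact (hcoup i l (fun h => hil (by rw [h]))).trans
        (mul_le_mul_of_nonneg_right (mul_le_mul_of_nonneg_right hCR ht2) hlv0)
  · -- (p5) spread
    rcases Fin.eq_zero_or_eq_succ (Fin.last k) with h0 | ⟨j, hj⟩
    · rw [h0]
      simp only [Fin.cons_zero]
      rw [hqΩ, sub_self]
      exact mul_nonneg (mul_nonneg hR0 ht1) hlv0
    · rw [hj]
      simp only [Fin.cons_zero, Fin.cons_succ]
      rw [hqΩ]
      exact (hsprC j).trans (mul_le_mul_of_nonneg_right (mul_le_mul_of_nonneg_right hC'R ht1) hlv0)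
  · -- (p6) top capture for free
    simp only [Fin.cons_zero]
    rw [hqΩ]
    have hexp : 1 ≤ Real.exp (η * luscherLambda β L / L) :=
      Real.one_le_exp (div_nonneg (mul_nonneg hη.le hlam_nn) hLnn)
    have hl2 : 0 ≤ l2 ψ ψ := l2_self_nonneg ψ
    rcases hl2.eq_or_lt with h0 | hpos
    · rw [← h0, mul_zero, qform_eq_zero_of_l2_eq_zero β hψ h0.symm]
    · calc qform su2Rep β ψ ψ ≤ levelValue su2Rep L β 0 * l2 ψ ψ :=
            qform_le_levelValue_zero_mul su2Rep continuous_su2Rep β hψ hpos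
        _ = 1 * levelValue su2Rep L β 0 * l2 ψ ψ := by rw [one_mul]
        _ ≤ Real.exp (η * luscherLambda β L / L) * levelValue su2Rep L β 0 * l2 ψ ψ :=
            mul_le_mul_of_nonneg_right (mul_le_mul_of_nonneg_right hexp hlv0) hl2

/-- Corollaries: `ExcitedPlateau → RitzGenerators` and `→ DressedRitz` (`= stub_dressedRitz` of «KTR»). [folklore] -/
theorem ritzGenerators_of_excitedPlateau (h : ExcitedPlateau) : RitzGenerators :=
  ritzGenerators_of_diagonalPlateau (diagonalPlateau_of_excitedPlateau h)

theorem dressedRitz_of_excitedPlateau (h : ExcitedPlateau) : DressedRitz :=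
  dressedRitz_of_diagonalPlateau (diagonalPlateau_of_excitedPlateau h)

/-! ## §10 (rev 3) NON-VACUITY CERTIFICATES: `RunningReduction → OneSiteLevels → ExcitedPlateau (→ DiagonalPlateau → RitzGenerators)` -/

/-- ★★ **NON-VACUITY CERTIFICATE for the excited-sector cut: `RunningReduction → OneSiteLevels → ExcitedPlateau`.**  Witnesses: the exact
physical `l2`-orthonormal eigenfamily `K_βφ_j = λ_jφ_j`, `j ≤ k` (`PhysL2.exists_isPhys_eigenfamily`; `λ_k > 0` deep in the window by
`levelValue_pos_of_red_one`), `Ω := φ₀`, `w_i := φ_{i+1}`.  Then (x2), (x3), (x4), (x6) hold with value `0`; (x1) is `levelValue_antitone`; (x5) IS RED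
at levels `1 … k` (`runningReduction_uniform`); (x7) is `λ₀ − λ_{i+1} ≤ λ₀ − λ_k ≤ C'(λ/L)λ₀` (`spread_le_of_red_one` from the LOWER laws of
RED ∧ ONE, `λ ≤ 2·lam ≤ 1 ≤ L`).  One constant `C' := |C_RED| + |Δ_k| + |C_ONE|`, `lam0' := min lam0_RED (min (1/2) (1/(4·max B₀ 1)))`.  So the cut is
implied by the route's two cruxes: satisfiable exactly when they hold, not over-strong. [cite: ReedSimonIV1978, Thm. XIII.1] [cite: Luscher1983, §3] -/
theorem excitedPlateau_of_runningReduction_oneSiteLevels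
    (hRED : Summit.QuantumFields.YangMills.Theses.LuscherReduction.RunningReduction)
    (hONE : Summit.QuantumFields.YangMills.Theses.LuscherReduction.OneSiteLevels) :
    ExcitedPlateau := by
  intro k
  obtain ⟨C, lam0, hlam0, hC⟩ := runningReduction_uniform hRED k
  obtain ⟨Ck, B0, hB0⟩ := hONE k
  have hCC' : C ≤ |C| + |levelGap k| + |Ck| := by
    linarith [le_abs_self C, abs_nonneg (levelGap k), abs_nonneg Ck]
  have hC'0 : 0 ≤ |C| + |levelGap k| + |Ck| := by positivity
  refine ⟨|C| + |levelGap k| + |Ck|, min lam0 (min (1 / 2) (1 / (4 * max B0 1))),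
    lt_min hlam0 (lt_min (by norm_num) (by positivity)), fun lam hlam hle => ?_⟩
  obtain ⟨L0, hL⟩ := hC lam hlam (hle.trans (min_le_left _ _))
  refine ⟨L0, fun L _ hL0 β hW => ?_⟩
  have hlam_half : lam ≤ 1 / 2 := (hle.trans (min_le_right _ _)).trans (min_le_left _ _)
  have hlam1 : lam ≤ 1 := hlam_half.trans (by norm_num)
  have hlamB : lam ≤ 1 / (4 * max B0 1) := (hle.trans (min_le_right _ _)).trans (min_le_right _ _)
  have hβ : (0 : ℝ) ≤ β := zero_le_one.trans hW.1
  have hB : 0 ≤ oneSiteCoupling β L := oneSiteCoupling_nonneg β L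
  have hlam_nn : 0 ≤ luscherLambda β L := luscherLambda_nonneg β L
  have hlpos : 0 < luscherLambda β L := luscherLambda_pos_of_window hlam hW
  have hΛ1 : luscherLambda β L ≤ 1 := by linarith [hW.2.2]
  have hL1 : (1 : ℝ) ≤ (L : ℝ) := by exact_mod_cast NeZero.one_le
  have hLnn : (0 : ℝ) ≤ (L : ℝ) := Nat.cast_nonneg L
  have ht1 : 0 ≤ luscherLambda β L / L := div_nonneg hlam_nn hLnn
  have ht2 : 0 ≤ luscherLambda β L ^ 2 / L := div_nonneg (sq_nonneg _) hLnn
  have ht3 : 0 ≤ luscherLambda β L ^ 3 / (L : ℝ) ^ 2 := div_nonneg (pow_nonneg hlam_nn 3) (sq_nonneg _)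
  have hlv0 : 0 ≤ levelValue su2Rep L β 0 := levelValue_su2Rep_nonneg L hβ 0
  -- positivity of `λ_k`, then spectral attainment of the levels `0 … k`
  have hk : 0 < levelValue su2Rep L β k :=
    levelValue_pos_of_red_one hlam hlam1 hlamB hW (fun B hB => ⟨(hB0 B hB).1, (hB0 B hB).2.2⟩)
      (hL L hL0 β hW k le_rfl).2
  obtain ⟨φ, hφ, hon, heig⟩ := exists_isPhys_eigenfamily hβ k hk
  have hritz : ∀ i : Fin (k + 1), qform su2Rep β (φ i) (φ i) = levelValue su2Rep L β i := ritz_of_eigen hon heig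
  -- the level-`k` spread from the lower laws of RED ∧ ONE, and monotonicity of the levels
  have hsp : levelValue su2Rep L β 0 - levelValue su2Rep L β k
      ≤ (|C| + |levelGap k| + |Ck|) * (luscherLambda β L / L) * levelValue su2Rep L β 0 := by
    have hB0le : B0 ≤ oneSiteCoupling β L := oneSiteCoupling_ge_of_small_level hlam hlam1 hlamB hW
    obtain ⟨hμ0, -, hlow⟩ := hB0 _ hB0le
    rw [bareLambda_oneSiteCoupling hlpos] at hlow
    exact spread_le_of_red_one hμ0 hlv0 hlam_nn hΛ1 hL1 hlow (hL L hL0 β hW k le_rfl).2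
  have hsucc_le : ∀ i : Fin k, (i : ℕ) + 1 ≤ k := fun i => Nat.succ_le_of_lt i.2
  refine ⟨fun i => φ i.succ, fun i => hφ i.succ, fun i => ?_, fun i l hil => ?_, fun i l hil => ?_,
    ⟨φ 0, hφ 0, ?_, ?_, fun i => ?_⟩, fun i => ?_, fun i => ?_, fun i l hil => ?_, fun i => ?_⟩
  · -- unit norm
    rw [hon i.succ i.succ, if_pos rfl]
  · -- (x1) sorted diagonal values
    rw [hritz, hritz]
    exact levelValue_antitone hβ (Fin.le_def.mp (Fin.succ_le_succ_iff.mpr hil))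
  · -- (x2) near-orthogonality, here exact
    rw [hon i.succ l.succ, if_neg (fun h => hil (Fin.succ_injective _ h)), abs_zero]
    exact mul_nonneg hC'0 hlam_nn
  · -- (x3) the vacuum `Ω := φ₀`: unit norm
    rw [hon 0 0, if_pos rfl]
  · -- (x3) eigen-equation at level `0`
    rw [heig 0, Fin.val_zero]
  · -- (x3) vacuum overlaps, here exact zero
    rw [hon 0 i.succ, if_neg (Fin.succ_ne_zero i).symm, abs_zero]
    exact mul_nonneg hC'0 hlam_nn
  · -- (x4) one-step residual, here zero
    have hz : transferApply β (φ i.succ) - qform su2Rep β (φ i.succ) (φ i.succ) • φ i.succ = 0 := by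
      rw [heig i.succ, hritz i.succ, sub_self]
    rw [hz, l2_zero_zero]
    exact mul_nonneg (mul_nonneg hC'0 ht3) (sq_nonneg _)
  · -- (x5) Lüscher position against `λ₀` = RED at level `i+1 ≤ k`
    rw [hritz i.succ, Fin.val_succ]
    obtain ⟨ha, hb⟩ := hL L hL0 β hW ((i : ℕ) + 1) (hsucc_le i)
    have hY₁ : 0 ≤ levelValue su2Rep 1 (oneSiteCoupling β L) ((i : ℕ) + 1) * levelValue su2Rep L β 0 :=
      mul_nonneg (levelValue_su2Rep_nonneg 1 hB _) hlv0
    have hY₂ : 0 ≤ levelValue su2Rep L β ((i : ℕ) + 1) * levelValue su2Rep 1 (oneSiteCoupling β L) 0 :=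
      mul_nonneg (levelValue_su2Rep_nonneg L hβ _) (levelValue_su2Rep_nonneg 1 hB 0)
    exact ⟨le_exp_mul_div_of_le ha ht2 hY₁ hCC', le_exp_mul_div_of_le hb ht2 hY₂ hCC'⟩
  · -- (x6) symmetrised excited couplings, here zero
    have hne : i.succ ≠ l.succ := fun h => hil (Fin.succ_injective _ h)
    rw [qform_of_eigen_orthonormal hon heig i.succ l.succ, if_neg hne, hon i.succ l.succ, if_neg hne, mul_zero, sub_zero,
      abs_zero]
    exact mul_nonneg (mul_nonneg hC'0 ht2) hlv0
  · -- (x7) spread at level `i+1 ≤ k`: `λ₀ − λ_{i+1} ≤ λ₀ − λ_k`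
    rw [hritz i.succ, Fin.val_succ]
    have hmono : levelValue su2Rep L β k ≤ levelValue su2Rep L β ((i : ℕ) + 1) := levelValue_antitone hβ (hsucc_le i)
    linarith

/-- Corollary (replaces the direct proof of rev 3 draft): **`RunningReduction → OneSiteLevels → DiagonalPlateau`** through the excited cut.
[cite: ReedSimonIV1978, Thm. XIII.1] -/
theorem diagonalPlateau_of_runningReduction_oneSiteLevels
    (hRED : Summit.QuantumFields.YangMills.Theses.LuscherReduction.RunningReduction)
    (hONE : Summit.QuantumFields.YangMills.Theses.LuscherReduction.OneSiteLevels) :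
    DiagonalPlateau :=
  diagonalPlateau_of_excitedPlateau (excitedPlateau_of_runningReduction_oneSiteLevels hRED hONE)

/-- Corollary: `RunningReduction → OneSiteLevels → RitzGenerators` through the SAME cuts (re-deriving the tree's
`KTRCertificate.dressedRitz_of_runningReduction_oneSiteLevels` via `ExcitedPlateau → DiagonalPlateau → RitzGenerators → DressedRitz`). [folklore] -/
theorem ritzGenerators_of_runningReduction_oneSiteLevels
    (hRED : Summit.QuantumFields.YangMills.Theses.LuscherReduction.RunningReduction)
    (hONE : Summit.QuantumFields.YangMills.Theses.LuscherReduction.OneSiteLevels) :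
    RitzGenerators :=
  ritzGenerators_of_diagonalPlateau (diagonalPlateau_of_runningReduction_oneSiteLevels hRED hONE)

end Summit.QuantumFields.YangMills.Cruxes.RunningReduction.KTGen

end
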